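import Literature.MathematicalPhysics.KineticTheory.HardSphereWindowFlux
import Literature.Analysis.FluidPDE.HardSphereWindowCount
import Literature.Analysis.FluidPDE.HardSphereUniqueness
import HarnessLib

/-!
# Towards the one-step mild BBGKY hierarchy almost everywhere: the window analysis
(Cercignani–Illner–Pulvirenti 1994 §4.3 (3.5)–(3.7), Thm 4.3.1, App. 4.A–4.B; Spohn 2006 Prop. 5;
trunk T-KINETIC, topic MathematicalPhysics/KineticTheory; assembly, per time window, of the
input (H1) of `hs_seriesFamily_ae_eq_of_oneStep` from the single-collision events
(`HardSphereWindowEvent`, `HardSphereWindowCount`, `HardSphereWindowFlux`).)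

For the tagged `k`-block of `k + m` hard spheres on `T^d` (`0 < ε < 1/2`) and the regularised
flow `Φ` (`regFlow`, a group action on all of phase space), the weak form of the `k`-marginal
against `1_B ∘ Φ^k_{-t}` is `∫_{good} 1_{Φ^k_t B}(π Φ_t z₀) W(z₀) dz₀` (`setIntegral_marginal_flow_eq`).
This file analyses its increment over a window `[a, a + δ]`:

* §Relabel — covariance of the single-collision event under relabellings
  (`comp_perm_mem_singleCollisionEvent_iff`) and the relabelled integrals
  (`lintegral_singleCollisionEvent_comp_perm`, `integral_singleCollisionEvent_comp_perm`);
* §GeneralIndex — `lintegral_singleCollisionEvent_eq` for `n` old spheres and its signed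
  (Bochner) form on the product of the collision coordinates (`integral_singleCollisionEvent_eq`);
* §Bracket — the group action (`regFlow_mem_image_iff`, `mem_image_regFlow_iff`,
  `measurePreserving_regFlow_volume`), free stretches of the regularised flow
  (`regFlow_eq_freeFlight_of_lt`, `regFlow_neg_eq_freeFlight_of_le`), the flow at the collision
  instant (`regFlow_collisionInstant_eq_of_mem`) and the window bracket on the event
  (`bracket_of_mem_singleCollisionEvent`);
* §Classify — disjointness of the events of distinct tagged–untagged pairs and the pointwise
  classification of the windows (`abs_increment_sub_sum_le`: off the events the increment is
  supported in the dirty windows and the null non-good tagged blocks);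
* §Window — Liouville transfer of the event terms (`setIntegral_event_increment_eq`), reduction
  of every untagged collider to the last one (`event_term_relabel`), the event term in collision
  coordinates with its slow/generic cut-off errors (`event_term_eq_flux`), and the resulting
  decomposition of a window increment (`window_increment_decomposition`).

## References

* C. Cercignani, R. Illner, M. Pulvirenti, *The Mathematical Theory of Dilute Gases*, Springer
  (1994), §4.3, App. 4.A pp. 107–111, App. 4.B.
* H. Spohn, *On the integrated form of the BBGKY hierarchy for hard spheres*,
  arXiv:math-ph/0605068, Prop. 5.
* I. Gallagher, L. Saint-Raymond, B. Texier, *From Newton to Boltzmann*, EMS (2013),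
  arXiv:1208.5753, Prop. 4.1.1.
-/

open MeasureTheory MeasureTheory.Measure Metric Real Set Filter Function
open scoped ENNReal InnerProductSpace
open Literature.Analysis.FluidPDE Literature.Analysis

namespace Literature.MathematicalPhysics.KineticTheory

noncomputable section

section Kinetic

variable {d : Type*} [Fintype d]

section Relabel

variable {ε : ℝ} (hε : 0 < ε) (hε' : ε < 2⁻¹) {N : ℕ}

include hε hε'

/-- **Covariance of the single-collision event under relabelling** (torus, `0 < ε < 1/2`): for a
permutation `σ` and a datum `z` which is good together with `z ∘ σ`, and `δ > 0`, `I ≠ J`,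
`z ∘ σ ∈ singleCollisionEvent I J δ ↔ z ∈ singleCollisionEvent (σ I) (σ J) δ`. [folklore] -/
theorem comp_perm_mem_singleCollisionEvent_iff (σ : Equiv.Perm (Fin N)) {z : Config N d (UnitAddTorus d)}
    (hz : z ∈ Alexander.good (Torus.geometry d) ε) (hzσ : (z ∘ σ : Config N d (UnitAddTorus d)) ∈ Alexander.good (Torus.geometry d) ε)
    {I J : Fin N} (hIJ : I ≠ J) {δ : ℝ} (hδ : 0 < δ) :
    (z ∘ σ : Config N d (UnitAddTorus d)) ∈ Alexander.singleCollisionEvent (Torus.geometry d) ε I J δ ↔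
      z ∈ Alexander.singleCollisionEvent (Torus.geometry d) ε (σ I) (σ J) δ := by
  have hG := Torus.isHardSphereRegular_geometry (d := d) hε'
  have hσIJ : σ I ≠ σ J := fun h => hIJ (σ.injective h)
  set Φ := Alexander.regHardSphereFlow (d := d) hε hε' N with hΦ
  -- orbits are covariant
  have hflow : ∀ τ : ℝ, 0 ≤ τ → Alexander.fwdFlow (Torus.geometry d) ε (z ∘ σ) τ =
      (Alexander.fwdFlow (Torus.geometry d) ε z τ ∘ σ : Config N d (UnitAddTorus d)) := by
    intro τ hτ
    have h := Φ.flow_comp_perm_of_nonneg σ (z := z) hz hzσ hτ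
    simp only [hΦ, Alexander.regHardSphereFlow_flow, Alexander.regFlow_of_mem hz, Alexander.regFlow_of_mem hzσ,
      Alexander.flow_of_nonneg hτ] at h
    exact h
  rw [Alexander.mem_singleCollisionEvent_iff_orbit hG hIJ hδ, Alexander.mem_singleCollisionEvent_iff_orbit hG hσIJ hδ]
  have hcontact : ∀ τ : ℝ, 0 ≤ τ → ∀ i j : Fin N,
      Alexander.fwdFlow (Torus.geometry d) ε (z ∘ σ) τ ∈ contactSet (Torus.geometry d) N ε i j ↔
        Alexander.fwdFlow (Torus.geometry d) ε z τ ∈ contactSet (Torus.geometry d) N ε (σ i) (σ j) := by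
    intro τ hτ i j
    rw [hflow τ hτ, perm_mem_contactSet_iff]
  have hex : ∀ τ : ℝ, 0 ≤ τ → ((∃ i j : Fin N, i ≠ j ∧ Alexander.fwdFlow (Torus.geometry d) ε (z ∘ σ) τ ∈ contactSet (Torus.geometry d) N ε i j) ↔
      ∃ i j : Fin N, i ≠ j ∧ Alexander.fwdFlow (Torus.geometry d) ε z τ ∈ contactSet (Torus.geometry d) N ε i j) := by
    intro τ hτ
    constructor
    · rintro ⟨i, j, hij, hc⟩
      exact ⟨σ i, σ j, fun h => hij (σ.injective h), (hcontact τ hτ i j).1 hc⟩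
    · rintro ⟨i, j, hij, hc⟩
      refine ⟨σ.symm i, σ.symm j, fun h => hij (σ.symm.injective h), ?_⟩
      rw [hcontact τ hτ]; simpa using hc
  constructor
  · rintro ⟨-, ⟨τ, hτ, hc⟩, huniq⟩
    refine ⟨hz, ⟨τ, hτ, (hcontact τ hτ.1.le I J).1 hc⟩, fun τ₁ hτ₁ τ₂ hτ₂ h₁ h₂ => ?_⟩
    exact huniq τ₁ hτ₁ τ₂ hτ₂ ((hex τ₁ hτ₁.1.le).2 h₁) ((hex τ₂ hτ₂.1.le).2 h₂)
  · rintro ⟨-, ⟨τ, hτ, hc⟩, huniq⟩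
    refine ⟨hzσ, ⟨τ, hτ, (hcontact τ hτ.1.le I J).2 hc⟩, fun τ₁ hτ₁ τ₂ hτ₂ h₁ h₂ => ?_⟩
    exact huniq τ₁ hτ₁ τ₂ hτ₂ ((hex τ₁ hτ₁.1.le).1 h₁) ((hex τ₂ hτ₂.1.le).1 h₂)

/-- **Relabelling the collider in the Lebesgue integral over a single-collision event**: for a
permutation `σ`, measurable `F ≥ 0`, `δ > 0` and `I ≠ J`,
`∫ 1_{E(σ I, σ J)}(z) F(z) dz = ∫ 1_{E(I, J)}(z) F(z ∘ σ⁻¹) dz` (relabelling preserves Lebesgue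
measure; the events correspond on the data good together with their relabelling, a conull set).
[folklore] -/
theorem lintegral_singleCollisionEvent_comp_perm (σ : Equiv.Perm (Fin N)) {I J : Fin N} (hIJ : I ≠ J) {δ : ℝ} (hδ : 0 < δ)
    (F : Config N d (UnitAddTorus d) → ℝ≥0∞) (hF : Measurable F) :
    ∫⁻ z, (Alexander.singleCollisionEvent (Torus.geometry d) ε (σ I) (σ J) δ).indicator F z =
      ∫⁻ z, (Alexander.singleCollisionEvent (Torus.geometry d) ε I J δ).indicator
        (fun z => F (z ∘ σ.symm : Config N d (UnitAddTorus d))) z := by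
  haveI hXE : SigmaFinite (volume : Measure (UnitAddTorus d × EuclideanSpace ℝ d)) := inferInstance
  have hG := Torus.isHardSphereRegular_geometry (d := d) hε'
  have hGm := Torus.isMeasurable_geometry (d := d)
  set Φ := Alexander.regHardSphereFlow (d := d) hε hε' N with hΦ
  -- relabelling as a volume-preserving measurable equivalence
  set e := MeasurableEquiv.piCongrLeft (fun _ : Fin N => UnitAddTorus d × EuclideanSpace ℝ d) σ.symm with hedef
  have he : (e : Config N d (UnitAddTorus d) → Config N d (UnitAddTorus d)) = fun z => (z ∘ σ : Config N d (UnitAddTorus d)) := by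
    funext z i
    simp [hedef, MeasurableEquiv.coe_piCongrLeft, Equiv.piCongrLeft_apply_eq_cast]
  have hvol : MeasurePreserving e volume volume :=
    volume_measurePreserving_piCongrLeft (fun _ : Fin N => UnitAddTorus d × EuclideanSpace ℝ d) σ.symm
  -- the events
  have hE := Alexander.measurableSet_singleCollisionEvent hG hGm (Alexander.measurableSet_good hG hGm) I J δ (N := N)
  have hEσ := Alexander.measurableSet_singleCollisionEvent hG hGm (Alexander.measurableSet_good hG hGm) (σ I) (σ J) δ (N := N)
  -- change of variables `z ↦ z ∘ σ` in the right-hand side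
  have hmeas : Measurable fun z : Config N d (UnitAddTorus d) =>
      (Alexander.singleCollisionEvent (Torus.geometry d) ε I J δ).indicator
        (fun z => F (z ∘ σ.symm : Config N d (UnitAddTorus d))) z := by
    refine Measurable.indicator ?_ hE
    have h2 : Measurable fun z : Config N d (UnitAddTorus d) => (z ∘ σ.symm : Config N d (UnitAddTorus d)) :=
      measurable_pi_lambda _ fun i => measurable_pi_apply _
    exact hF.comp h2
  rw [← hvol.lintegral_comp hmeas, he]
  -- the integrands agree almost everywhere (on data good together with their relabelling)
  have hgood : ∀ᵐ z : Config N d (UnitAddTorus d), z ∈ hardSphereDomain (Torus.geometry d) N ε →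
      z ∈ Alexander.good (Torus.geometry d) ε := by
    have h := Φ.measure_compl_good
    rw [liouville_eq, Measure.restrict_apply' (measurableSet_hardSphereDomain _ Torus.measurable_geometry_sepVec N ε)] at h
    have h' : ∀ᵐ z : Config N d (UnitAddTorus d), z ∉ Φ.goodᶜ ∩ hardSphereDomain (Torus.geometry d) N ε :=
      measure_eq_zero_iff_ae_notMem.1 h
    filter_upwards [h'] with z hz hzD
    by_contra hng
    exact hz ⟨hng, hzD⟩
  have hgoodσ : ∀ᵐ z : Config N d (UnitAddTorus d), z ∈ hardSphereDomain (Torus.geometry d) N ε →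
      (z ∘ σ : Config N d (UnitAddTorus d)) ∈ Alexander.good (Torus.geometry d) ε := by
    have h := Φ.ae_comp_perm_mem_good σ
    rw [liouville_eq, ae_restrict_iff' (measurableSet_hardSphereDomain _ Torus.measurable_geometry_sepVec N ε)] at h
    exact h
  refine lintegral_congr_ae ?_
  filter_upwards [hgood, hgoodσ] with z hz hzσ
  have hσσ : ((z ∘ σ) ∘ σ.symm : Config N d (UnitAddTorus d)) = z := by
    funext i; simp
  by_cases hzD : z ∈ hardSphereDomain (Torus.geometry d) N ε
  · have hzg := hz hzD
    have hzσg := hzσ hzD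
    by_cases hmem : z ∈ Alexander.singleCollisionEvent (Torus.geometry d) ε (σ I) (σ J) δ
    · rw [indicator_of_mem hmem, indicator_of_mem ((comp_perm_mem_singleCollisionEvent_iff hε hε' σ hzg hzσg hIJ hδ).2 hmem), hσσ]
    · rw [indicator_of_notMem hmem, indicator_of_notMem]
      exact fun h => hmem ((comp_perm_mem_singleCollisionEvent_iff hε hε' σ hzg hzσg hIJ hδ).1 h)
  · -- off the domain both events are empty (good data lie in the domain)
    have h1 : z ∉ Alexander.singleCollisionEvent (Torus.geometry d) ε (σ I) (σ J) δ :=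
      fun h => hzD (Alexander.good_subset_hardSphereDomain h.1)
    have h2 : (z ∘ σ : Config N d (UnitAddTorus d)) ∉ Alexander.singleCollisionEvent (Torus.geometry d) ε I J δ :=
      fun h => hzD ((perm_mem_hardSphereDomain_iff σ z).1 (Alexander.good_subset_hardSphereDomain h.1))
    rw [indicator_of_notMem h1, indicator_of_notMem h2]

end Relabel

section GeneralIndex

variable {ε : ℝ} (hε : 0 < ε) (hε' : ε < 2⁻¹)

include hε hε'

/-- `lintegral_singleCollisionEvent_eq` for `n` old spheres, `n ≠ 0` (the statement for `s + 1`
old spheres after `n = s + 1`). [cite: CIP1994, App. 4.B] -/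
theorem lintegral_singleCollisionEvent_eq_of_neZero [Nonempty d] {n : ℕ} [NeZero n] (i : Fin n)
    {ρ δ V : ℝ} (hρ : ρ < 1 / 2) (hδV : ε + δ * V ≤ ρ)
    (H : ℝ → Config (n + 1) d (UnitAddTorus d) → ℝ≥0∞)
    (hH : Measurable fun p : ℝ × Config (n + 1) d (UnitAddTorus d) => H p.1 p.2) :
    ∫⁻ z : Config (n + 1) d (UnitAddTorus d),
        (Alexander.singleCollisionEvent (Torus.geometry d) ε (Fin.castAdd 1 i) (Fin.natAdd n 0) δ).indicator
          (fun z => {z : Config (n + 1) d (UnitAddTorus d) | ‖(z (Fin.natAdd n 0)).2 - (z (Fin.castAdd 1 i)).2‖ ≤ V}.indicator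
            (fun z => H (Alexander.collisionInstant (Torus.geometry d) ε z 1).toReal
              (outRep (Torus.geometry d) n i
                (freeFlight (Torus.geometry d) (Alexander.collisionInstant (Torus.geometry d) ε z 1).toReal z))) z) z =
      ∫⁻ Z' : Config n d (UnitAddTorus d), ∫⁻ v : EuclideanSpace ℝ d,
        ∫⁻ ν : sphere (0 : EuclideanSpace ℝ d) 1, ∫⁻ τ in Ioc (0 : ℝ) δ,
          (collisionCylDom (v - (Z' i).2)).indicator (fun _ => (1 : ℝ≥0∞)) (ν : EuclideanSpace ℝ d) *
            (ENNReal.ofReal (ε ^ (Fintype.card d - 1) * ⟪v - (Z' i).2, (ν : EuclideanSpace ℝ d)⟫_ℝ) *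
              ({v : EuclideanSpace ℝ d | ‖v - (Z' i).2‖ ≤ V}.indicator (fun _ => (1 : ℝ≥0∞)) v *
                ((Alexander.singleCollisionEvent (Torus.geometry d) ε (Fin.castAdd 1 i) (Fin.natAdd n 0) δ).indicator
                  (fun _ => (1 : ℝ≥0∞)) (freeFlight (Torus.geometry d) (-τ) (gainConfig (Torus.geometry d) ε Z' i ν v)) *
                  H τ (lossConfig (Torus.geometry d) ε Z' i ν v))))
          ∂volume ∂(volume : Measure (EuclideanSpace ℝ d)).toSphere := by
  obtain ⟨s, rfl⟩ := Nat.exists_eq_succ_of_ne_zero (NeZero.ne n)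
  exact lintegral_singleCollisionEvent_eq hε hε' i hρ hδV H hH


omit hε hε' in
/-- Four iterated Lebesgue integrals over `Z'`, `v`, `ν ∈ S^{d-1}`, `τ ∈ (0, δ]` as one integral over
the product. [folklore] -/
theorem lintegral_iterated₄_eq_prod {n : ℕ} (δ : ℝ)
    (F : (Config n d (UnitAddTorus d) × EuclideanSpace ℝ d) × (sphere (0 : EuclideanSpace ℝ d) 1 × ℝ) → ℝ≥0∞)
    (hF : Measurable F) :
    ∫⁻ Z : Config n d (UnitAddTorus d), ∫⁻ v : EuclideanSpace ℝ d, ∫⁻ ν : sphere (0 : EuclideanSpace ℝ d) 1, ∫⁻ τ in Ioc (0 : ℝ) δ,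
        F ((Z, v), (ν, τ)) ∂volume ∂(volume : Measure (EuclideanSpace ℝ d)).toSphere =
      ∫⁻ p, F p ∂(((volume : Measure (Config n d (UnitAddTorus d))).prod (volume : Measure (EuclideanSpace ℝ d))).prod
        ((((volume : Measure (EuclideanSpace ℝ d)).toSphere).prod ((volume : Measure ℝ).restrict (Ioc 0 δ))))) := by
  haveI hXE : SigmaFinite (volume : Measure (UnitAddTorus d × EuclideanSpace ℝ d)) := inferInstance
  haveI hC : SigmaFinite (volume : Measure (Config n d (UnitAddTorus d))) := inferInstance
  haveI hσf : IsFiniteMeasure ((volume : Measure (EuclideanSpace ℝ d)).toSphere) := inferInstance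
  haveI hσp : SFinite (((volume : Measure (EuclideanSpace ℝ d)).toSphere).prod ((volume : Measure ℝ).restrict (Ioc 0 δ))) :=
    inferInstance
  have h1 : ∀ (Z : Config n d (UnitAddTorus d)) (v : EuclideanSpace ℝ d),
      ∫⁻ ν : sphere (0 : EuclideanSpace ℝ d) 1, ∫⁻ τ in Ioc (0 : ℝ) δ, F ((Z, v), (ν, τ)) ∂volume
          ∂(volume : Measure (EuclideanSpace ℝ d)).toSphere =
        ∫⁻ q, F ((Z, v), q) ∂(((volume : Measure (EuclideanSpace ℝ d)).toSphere).prod ((volume : Measure ℝ).restrict (Ioc 0 δ))) := by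
    intro Z v
    rw [lintegral_prod (fun q : sphere (0 : EuclideanSpace ℝ d) 1 × ℝ => F ((Z, v), q))
      ((hF.comp (measurable_const.prodMk measurable_id)).aemeasurable)]
  simp_rw [h1]
  have h2 : ∫⁻ Z : Config n d (UnitAddTorus d), ∫⁻ v : EuclideanSpace ℝ d,
      ∫⁻ q, F ((Z, v), q) ∂(((volume : Measure (EuclideanSpace ℝ d)).toSphere).prod ((volume : Measure ℝ).restrict (Ioc 0 δ))) =
      ∫⁻ x, ∫⁻ q, F (x, q) ∂(((volume : Measure (EuclideanSpace ℝ d)).toSphere).prod ((volume : Measure ℝ).restrict (Ioc 0 δ)))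
        ∂((volume : Measure (Config n d (UnitAddTorus d))).prod (volume : Measure (EuclideanSpace ℝ d))) := by
    rw [lintegral_prod (fun x : Config n d (UnitAddTorus d) × EuclideanSpace ℝ d =>
      ∫⁻ q, F (x, q) ∂(((volume : Measure (EuclideanSpace ℝ d)).toSphere).prod ((volume : Measure ℝ).restrict (Ioc 0 δ))))
      (hF.lintegral_prod_right'.aemeasurable)]
  rw [h2, lintegral_prod _ hF.aemeasurable]


omit hε hε' in
/-- `ENNReal.ofReal` of a real indicator of `1` is the `ℝ≥0∞` indicator of `1`. [folklore] -/
theorem ofReal_indicator_one {α : Type*} (S : Set α) (x : α) :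
    ENNReal.ofReal (S.indicator (1 : α → ℝ) x) = S.indicator (fun _ => (1 : ℝ≥0∞)) x := by
  by_cases h : x ∈ S
  · rw [indicator_of_mem h, indicator_of_mem h, Pi.one_apply, ENNReal.ofReal_one]
  · rw [indicator_of_notMem h, indicator_of_notMem h, ENNReal.ofReal_zero]

omit hε hε' in
/-- The flux density `ε^{d-1} (⟪u, ν⟫)₊` in `ℝ≥0∞` form. [folklore] -/
theorem ofReal_flux_eq (ε : ℝ) (u : EuclideanSpace ℝ d) (ν : EuclideanSpace ℝ d) :
    ENNReal.ofReal (ε ^ (Fintype.card d - 1) * max ⟪u, ν⟫_ℝ 0) =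
      (collisionCylDom u).indicator (fun _ => (1 : ℝ≥0∞)) ν * ENNReal.ofReal (ε ^ (Fintype.card d - 1) * ⟪u, ν⟫_ℝ) := by
  by_cases h : 0 < ⟪u, ν⟫_ℝ
  · rw [indicator_of_mem (show ν ∈ collisionCylDom u from h), one_mul, max_eq_left h.le]
  · rw [indicator_of_notMem (show ν ∉ collisionCylDom u from h), zero_mul, max_eq_right (not_lt.1 h), mul_zero,
      ENNReal.ofReal_zero]

/-- **The single-collision event in collision coordinates, signed integrands** (Bochner form of
`lintegral_singleCollisionEvent_eq`): for a jointly measurable real `H` whose pull-back to the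
event is integrable, the integral over the slow part of the single-collision event of
`H(collision instant, outgoing configuration)` equals the integral over the collision
coordinates `((Z', v), (ν, τ))`, `τ ∈ (0, δ]`, of
`ε^{d-1} (⟪v - v_i, ν⟫)₊ 1_{‖v - v_i‖ ≤ V} 1_E(S_{-τ}(gainConfig Z' i ν v)) H(τ, lossConfig Z' i ν v)`,
an integrable function. [cite: CIP1994, App. 4.B] -/
theorem integral_singleCollisionEvent_eq [Nonempty d] {n : ℕ} [NeZero n] (i : Fin n)
    {ρ δ V : ℝ} (hρ : ρ < 1 / 2) (hδV : ε + δ * V ≤ ρ)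
    (H : ℝ → Config (n + 1) d (UnitAddTorus d) → ℝ)
    (hH : Measurable fun p : ℝ × Config (n + 1) d (UnitAddTorus d) => H p.1 p.2)
    (hint : Integrable fun z : Config (n + 1) d (UnitAddTorus d) =>
      (Alexander.singleCollisionEvent (Torus.geometry d) ε (Fin.castAdd 1 i) (Fin.natAdd n 0) δ).indicator
        (fun z => {z : Config (n + 1) d (UnitAddTorus d) | ‖(z (Fin.natAdd n 0)).2 - (z (Fin.castAdd 1 i)).2‖ ≤ V}.indicator
          (fun z => H (Alexander.collisionInstant (Torus.geometry d) ε z 1).toReal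
            (outRep (Torus.geometry d) n i
              (freeFlight (Torus.geometry d) (Alexander.collisionInstant (Torus.geometry d) ε z 1).toReal z))) z) z) :
    Integrable (fun p : (Config n d (UnitAddTorus d) × EuclideanSpace ℝ d) × (sphere (0 : EuclideanSpace ℝ d) 1 × ℝ) =>
        ε ^ (Fintype.card d - 1) * max ⟪p.1.2 - (p.1.1 i).2, (p.2.1 : EuclideanSpace ℝ d)⟫_ℝ 0 *
          {v : EuclideanSpace ℝ d | ‖v - (p.1.1 i).2‖ ≤ V}.indicator (1 : EuclideanSpace ℝ d → ℝ) p.1.2 *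
          (Alexander.singleCollisionEvent (Torus.geometry d) ε (Fin.castAdd 1 i) (Fin.natAdd n 0) δ).indicator
            (1 : Config (n + 1) d (UnitAddTorus d) → ℝ)
            (freeFlight (Torus.geometry d) (-p.2.2) (gainConfig (Torus.geometry d) ε p.1.1 i p.2.1 p.1.2)) *
          H p.2.2 (lossConfig (Torus.geometry d) ε p.1.1 i p.2.1 p.1.2))
      ((((volume : Measure (Config n d (UnitAddTorus d))).prod (volume : Measure (EuclideanSpace ℝ d))).prod
        ((((volume : Measure (EuclideanSpace ℝ d)).toSphere).prod ((volume : Measure ℝ).restrict (Ioc 0 δ)))))) ∧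
    ∫ z : Config (n + 1) d (UnitAddTorus d),
        (Alexander.singleCollisionEvent (Torus.geometry d) ε (Fin.castAdd 1 i) (Fin.natAdd n 0) δ).indicator
          (fun z => {z : Config (n + 1) d (UnitAddTorus d) | ‖(z (Fin.natAdd n 0)).2 - (z (Fin.castAdd 1 i)).2‖ ≤ V}.indicator
            (fun z => H (Alexander.collisionInstant (Torus.geometry d) ε z 1).toReal
              (outRep (Torus.geometry d) n i
                (freeFlight (Torus.geometry d) (Alexander.collisionInstant (Torus.geometry d) ε z 1).toReal z))) z) z =
      ∫ p, ε ^ (Fintype.card d - 1) * max ⟪p.1.2 - (p.1.1 i).2, (p.2.1 : EuclideanSpace ℝ d)⟫_ℝ 0 *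
          {v : EuclideanSpace ℝ d | ‖v - (p.1.1 i).2‖ ≤ V}.indicator (1 : EuclideanSpace ℝ d → ℝ) p.1.2 *
          (Alexander.singleCollisionEvent (Torus.geometry d) ε (Fin.castAdd 1 i) (Fin.natAdd n 0) δ).indicator
            (1 : Config (n + 1) d (UnitAddTorus d) → ℝ)
            (freeFlight (Torus.geometry d) (-p.2.2) (gainConfig (Torus.geometry d) ε p.1.1 i p.2.1 p.1.2)) *
          H p.2.2 (lossConfig (Torus.geometry d) ε p.1.1 i p.2.1 p.1.2)
        ∂((((volume : Measure (Config n d (UnitAddTorus d))).prod (volume : Measure (EuclideanSpace ℝ d))).prod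
          ((((volume : Measure (EuclideanSpace ℝ d)).toSphere).prod ((volume : Measure ℝ).restrict (Ioc 0 δ)))))) := by
  classical
  have hG := Torus.isHardSphereRegular_geometry (d := d) hε'
  have hGm := Torus.isMeasurable_geometry (d := d)
  set G := Torus.geometry d with hGdef
  set E := Alexander.singleCollisionEvent G ε (Fin.castAdd 1 i) (Fin.natAdd n 0) δ with hE
  set t₁ : Config (n + 1) d (UnitAddTorus d) → ℝ := fun z => (Alexander.collisionInstant G ε z 1).toReal with ht₁
  set Sl : Set (Config (n + 1) d (UnitAddTorus d)) := {z | ‖(z (Fin.natAdd n 0)).2 - (z (Fin.castAdd 1 i)).2‖ ≤ V} with hSl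
  set μP := (((volume : Measure (Config n d (UnitAddTorus d))).prod (volume : Measure (EuclideanSpace ℝ d))).prod
    ((((volume : Measure (EuclideanSpace ℝ d)).toSphere).prod ((volume : Measure ℝ).restrict (Ioc 0 δ))))) with hμP
  -- the two integrands
  set f : Config (n + 1) d (UnitAddTorus d) → ℝ := fun z =>
    E.indicator (fun z => Sl.indicator (fun z => H (t₁ z) (outRep G n i (freeFlight G (t₁ z) z))) z) z with hf
  set g : (Config n d (UnitAddTorus d) × EuclideanSpace ℝ d) × (sphere (0 : EuclideanSpace ℝ d) 1 × ℝ) → ℝ := fun p =>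
    ε ^ (Fintype.card d - 1) * max ⟪p.1.2 - (p.1.1 i).2, (p.2.1 : EuclideanSpace ℝ d)⟫_ℝ 0 *
      {v : EuclideanSpace ℝ d | ‖v - (p.1.1 i).2‖ ≤ V}.indicator (1 : EuclideanSpace ℝ d → ℝ) p.1.2 *
      E.indicator (1 : Config (n + 1) d (UnitAddTorus d) → ℝ) (freeFlight G (-p.2.2) (gainConfig G ε p.1.1 i p.2.1 p.1.2)) *
      H p.2.2 (lossConfig G ε p.1.1 i p.2.1 p.1.2) with hg
  -- measurability
  have hEm : MeasurableSet E := Alexander.measurableSet_singleCollisionEvent hG hGm (Alexander.measurableSet_good hG hGm) _ _ δ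
  have ht₁m : Measurable t₁ := (Alexander.measurable_collisionInstant hG hGm 1).ennreal_toReal
  have hSlm : MeasurableSet Sl :=
    measurableSet_le (((measurable_pi_apply _).snd.sub (measurable_pi_apply _).snd).norm) measurable_const
  have hinner : ∀ (K : ℝ → Config (n + 1) d (UnitAddTorus d) → ℝ), (Measurable fun p : ℝ × Config (n + 1) d (UnitAddTorus d) => K p.1 p.2) →
      Measurable fun z : Config (n + 1) d (UnitAddTorus d) => K (t₁ z) (outRep G n i (freeFlight G (t₁ z) z)) := fun K hK =>
    hK.comp (ht₁m.prodMk ((measurable_outRep hGm n i).comp (hGm.measurable_freeFlight₂.comp (ht₁m.prodMk measurable_id))))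
  have hZ : Measurable fun p : (Config n d (UnitAddTorus d) × EuclideanSpace ℝ d) × (sphere (0 : EuclideanSpace ℝ d) 1 × ℝ) => p.1.1 :=
    measurable_fst.fst
  have hv : Measurable fun p : (Config n d (UnitAddTorus d) × EuclideanSpace ℝ d) × (sphere (0 : EuclideanSpace ℝ d) 1 × ℝ) => p.1.2 :=
    measurable_fst.snd
  have hν : Measurable fun p : (Config n d (UnitAddTorus d) × EuclideanSpace ℝ d) × (sphere (0 : EuclideanSpace ℝ d) 1 × ℝ) =>
      (p.2.1 : EuclideanSpace ℝ d) := continuous_subtype_val.measurable.comp measurable_snd.fst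
  have hτ : Measurable fun p : (Config n d (UnitAddTorus d) × EuclideanSpace ℝ d) × (sphere (0 : EuclideanSpace ℝ d) 1 × ℝ) => p.2.2 :=
    measurable_snd.snd
  have hvi : Measurable fun p : (Config n d (UnitAddTorus d) × EuclideanSpace ℝ d) × (sphere (0 : EuclideanSpace ℝ d) 1 × ℝ) =>
      (p.1.1 i).2 := ((measurable_pi_apply i).comp hZ).snd
  have hflux : Measurable fun p : (Config n d (UnitAddTorus d) × EuclideanSpace ℝ d) × (sphere (0 : EuclideanSpace ℝ d) 1 × ℝ) =>
      ε ^ (Fintype.card d - 1) * max ⟪p.1.2 - (p.1.1 i).2, (p.2.1 : EuclideanSpace ℝ d)⟫_ℝ 0 :=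
    measurable_const.mul (((hv.sub hvi).inner hν).max measurable_const)
  have hslowS : MeasurableSet {p : (Config n d (UnitAddTorus d) × EuclideanSpace ℝ d) × (sphere (0 : EuclideanSpace ℝ d) 1 × ℝ) |
      ‖p.1.2 - (p.1.1 i).2‖ ≤ V} := measurableSet_le (hv.sub hvi).norm measurable_const
  have hslow_eq : ∀ p : (Config n d (UnitAddTorus d) × EuclideanSpace ℝ d) × (sphere (0 : EuclideanSpace ℝ d) 1 × ℝ),
      {v : EuclideanSpace ℝ d | ‖v - (p.1.1 i).2‖ ≤ V}.indicator (1 : EuclideanSpace ℝ d → ℝ) p.1.2 =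
        {p : (Config n d (UnitAddTorus d) × EuclideanSpace ℝ d) × (sphere (0 : EuclideanSpace ℝ d) 1 × ℝ) |
          ‖p.1.2 - (p.1.1 i).2‖ ≤ V}.indicator
          (1 : (Config n d (UnitAddTorus d) × EuclideanSpace ℝ d) × (sphere (0 : EuclideanSpace ℝ d) 1 × ℝ) → ℝ) p := by
    intro p
    by_cases h : ‖p.1.2 - (p.1.1 i).2‖ ≤ V
    · rw [indicator_of_mem (show p.1.2 ∈ {v : EuclideanSpace ℝ d | ‖v - (p.1.1 i).2‖ ≤ V} from h),
        indicator_of_mem (show p ∈ {p : (Config n d (UnitAddTorus d) × EuclideanSpace ℝ d) × (sphere (0 : EuclideanSpace ℝ d) 1 × ℝ) |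
          ‖p.1.2 - (p.1.1 i).2‖ ≤ V} from h)]
      simp
    · rw [indicator_of_notMem (show p.1.2 ∉ {v : EuclideanSpace ℝ d | ‖v - (p.1.1 i).2‖ ≤ V} from h),
        indicator_of_notMem (show p ∉ {p : (Config n d (UnitAddTorus d) × EuclideanSpace ℝ d) × (sphere (0 : EuclideanSpace ℝ d) 1 × ℝ) |
          ‖p.1.2 - (p.1.1 i).2‖ ≤ V} from h)]
  have hslowm : Measurable fun p : (Config n d (UnitAddTorus d) × EuclideanSpace ℝ d) × (sphere (0 : EuclideanSpace ℝ d) 1 × ℝ) =>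
      {v : EuclideanSpace ℝ d | ‖v - (p.1.1 i).2‖ ≤ V}.indicator (1 : EuclideanSpace ℝ d → ℝ) p.1.2 := by
    simp_rw [hslow_eq]; exact measurable_const.indicator hslowS
  have hzτ : Measurable fun p : (Config n d (UnitAddTorus d) × EuclideanSpace ℝ d) × (sphere (0 : EuclideanSpace ℝ d) 1 × ℝ) =>
      freeFlight G (-p.2.2) (gainConfig G ε p.1.1 i p.2.1 p.1.2) :=
    hGm.measurable_freeFlight₂.comp (hτ.neg.prodMk (measurable_gainConfig hGm.measurable_translate ε i hZ hν hv))
  have hEind : Measurable fun p : (Config n d (UnitAddTorus d) × EuclideanSpace ℝ d) × (sphere (0 : EuclideanSpace ℝ d) 1 × ℝ) =>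
      E.indicator (1 : Config (n + 1) d (UnitAddTorus d) → ℝ) (freeFlight G (-p.2.2) (gainConfig G ε p.1.1 i p.2.1 p.1.2)) :=
    (measurable_const.indicator hEm).comp hzτ
  have hloss : Measurable fun p : (Config n d (UnitAddTorus d) × EuclideanSpace ℝ d) × (sphere (0 : EuclideanSpace ℝ d) 1 × ℝ) =>
      lossConfig G ε p.1.1 i p.2.1 p.1.2 := measurable_lossConfig hGm.measurable_translate ε i hZ hν hv
  have hHK : ∀ (K : ℝ → Config (n + 1) d (UnitAddTorus d) → ℝ), (Measurable fun p : ℝ × Config (n + 1) d (UnitAddTorus d) => K p.1 p.2) →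
      Measurable fun p : (Config n d (UnitAddTorus d) × EuclideanSpace ℝ d) × (sphere (0 : EuclideanSpace ℝ d) 1 × ℝ) =>
        K p.2.2 (lossConfig G ε p.1.1 i p.2.1 p.1.2) := fun K hK => hK.comp (hτ.prodMk hloss)
  have hgm : Measurable g := ((hflux.mul hslowm).mul hEind).mul (hHK H hH)
  -- the prefactor is nonnegative
  have hpre : ∀ p : (Config n d (UnitAddTorus d) × EuclideanSpace ℝ d) × (sphere (0 : EuclideanSpace ℝ d) 1 × ℝ),
      0 ≤ ε ^ (Fintype.card d - 1) * max ⟪p.1.2 - (p.1.1 i).2, (p.2.1 : EuclideanSpace ℝ d)⟫_ℝ 0 *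
        {v : EuclideanSpace ℝ d | ‖v - (p.1.1 i).2‖ ≤ V}.indicator (1 : EuclideanSpace ℝ d → ℝ) p.1.2 *
        E.indicator (1 : Config (n + 1) d (UnitAddTorus d) → ℝ) (freeFlight G (-p.2.2) (gainConfig G ε p.1.1 i p.2.1 p.1.2)) := by
    intro p
    refine mul_nonneg (mul_nonneg (mul_nonneg (pow_nonneg hε.le _) (le_max_right _ _))
      (Set.indicator_nonneg (fun _ _ => zero_le_one) _)) (Set.indicator_nonneg (fun _ _ => zero_le_one) _)
  -- the `ℝ≥0∞` form of `± g`
  have hofReal : ∀ (K : ℝ → Config (n + 1) d (UnitAddTorus d) → ℝ)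
      (p : (Config n d (UnitAddTorus d) × EuclideanSpace ℝ d) × (sphere (0 : EuclideanSpace ℝ d) 1 × ℝ)),
      ENNReal.ofReal (ε ^ (Fintype.card d - 1) * max ⟪p.1.2 - (p.1.1 i).2, (p.2.1 : EuclideanSpace ℝ d)⟫_ℝ 0 *
        {v : EuclideanSpace ℝ d | ‖v - (p.1.1 i).2‖ ≤ V}.indicator (1 : EuclideanSpace ℝ d → ℝ) p.1.2 *
        E.indicator (1 : Config (n + 1) d (UnitAddTorus d) → ℝ) (freeFlight G (-p.2.2) (gainConfig G ε p.1.1 i p.2.1 p.1.2)) *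
        K p.2.2 (lossConfig G ε p.1.1 i p.2.1 p.1.2)) =
      (collisionCylDom (p.1.2 - (p.1.1 i).2)).indicator (fun _ => (1 : ℝ≥0∞)) (p.2.1 : EuclideanSpace ℝ d) *
        (ENNReal.ofReal (ε ^ (Fintype.card d - 1) * ⟪p.1.2 - (p.1.1 i).2, (p.2.1 : EuclideanSpace ℝ d)⟫_ℝ) *
          ({v : EuclideanSpace ℝ d | ‖v - (p.1.1 i).2‖ ≤ V}.indicator (fun _ => (1 : ℝ≥0∞)) p.1.2 *
            (E.indicator (fun _ => (1 : ℝ≥0∞)) (freeFlight G (-p.2.2) (gainConfig G ε p.1.1 i p.2.1 p.1.2)) *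
              ENNReal.ofReal (K p.2.2 (lossConfig G ε p.1.1 i p.2.1 p.1.2))))) := by
    intro K p
    set A : ℝ := ε ^ (Fintype.card d - 1) * max ⟪p.1.2 - (p.1.1 i).2, (p.2.1 : EuclideanSpace ℝ d)⟫_ℝ 0 with hA
    set S : ℝ := {v : EuclideanSpace ℝ d | ‖v - (p.1.1 i).2‖ ≤ V}.indicator (1 : EuclideanSpace ℝ d → ℝ) p.1.2 with hS
    set T : ℝ := E.indicator (1 : Config (n + 1) d (UnitAddTorus d) → ℝ) (freeFlight G (-p.2.2) (gainConfig G ε p.1.1 i p.2.1 p.1.2)) with hT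
    set k : ℝ := K p.2.2 (lossConfig G ε p.1.1 i p.2.1 p.1.2) with hk
    have hA0 : 0 ≤ A := mul_nonneg (pow_nonneg hε.le _) (le_max_right _ _)
    have hS0 : 0 ≤ S := Set.indicator_nonneg (fun _ _ => zero_le_one) _
    have hT0 : 0 ≤ T := Set.indicator_nonneg (fun _ _ => zero_le_one) _
    have h1 : ENNReal.ofReal (A * S * T * k) = ENNReal.ofReal A * ENNReal.ofReal S * ENNReal.ofReal T * ENNReal.ofReal k := by
      rw [ENNReal.ofReal_mul (mul_nonneg (mul_nonneg hA0 hS0) hT0), ENNReal.ofReal_mul (mul_nonneg hA0 hS0), ENNReal.ofReal_mul hA0]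
    rw [h1, hA, ofReal_flux_eq, hS, ofReal_indicator_one, hT, ofReal_indicator_one]
    ring
  -- the `ℝ≥0∞` identities for `H` and `-H`
  have hcore : ∀ (K : ℝ → Config (n + 1) d (UnitAddTorus d) → ℝ), (Measurable fun p : ℝ × Config (n + 1) d (UnitAddTorus d) => K p.1 p.2) →
      ∫⁻ z, ENNReal.ofReal (E.indicator (fun z => Sl.indicator (fun z => K (t₁ z) (outRep G n i (freeFlight G (t₁ z) z))) z) z) =
        ∫⁻ p, ENNReal.ofReal (ε ^ (Fintype.card d - 1) * max ⟪p.1.2 - (p.1.1 i).2, (p.2.1 : EuclideanSpace ℝ d)⟫_ℝ 0 *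
          {v : EuclideanSpace ℝ d | ‖v - (p.1.1 i).2‖ ≤ V}.indicator (1 : EuclideanSpace ℝ d → ℝ) p.1.2 *
          E.indicator (1 : Config (n + 1) d (UnitAddTorus d) → ℝ) (freeFlight G (-p.2.2) (gainConfig G ε p.1.1 i p.2.1 p.1.2)) *
          K p.2.2 (lossConfig G ε p.1.1 i p.2.1 p.1.2)) ∂μP := by
    intro K hK
    have h1 : ∀ z, ENNReal.ofReal (E.indicator (fun z => Sl.indicator (fun z => K (t₁ z) (outRep G n i (freeFlight G (t₁ z) z))) z) z) =
        E.indicator (fun z => Sl.indicator (fun z => ENNReal.ofReal (K (t₁ z) (outRep G n i (freeFlight G (t₁ z) z)))) z) z := by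
      intro z
      by_cases hz : z ∈ E
      · rw [indicator_of_mem hz, indicator_of_mem hz]
        by_cases hs : z ∈ Sl
        · rw [indicator_of_mem hs, indicator_of_mem hs]
        · rw [indicator_of_notMem hs, indicator_of_notMem hs, ENNReal.ofReal_zero]
      · rw [indicator_of_notMem hz, indicator_of_notMem hz, ENNReal.ofReal_zero]
    simp_rw [h1, hofReal K]
    have hKm : Measurable fun p : ℝ × Config (n + 1) d (UnitAddTorus d) => ENNReal.ofReal (K p.1 p.2) :=
      ENNReal.measurable_ofReal.comp hK
    rw [lintegral_singleCollisionEvent_eq_of_neZero hε hε' i hρ hδV (fun τ w => ENNReal.ofReal (K τ w)) hKm]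
    refine lintegral_iterated₄_eq_prod δ (fun p => (collisionCylDom (p.1.2 - (p.1.1 i).2)).indicator (fun _ => (1 : ℝ≥0∞)) (p.2.1 : EuclideanSpace ℝ d) *
        (ENNReal.ofReal (ε ^ (Fintype.card d - 1) * ⟪p.1.2 - (p.1.1 i).2, (p.2.1 : EuclideanSpace ℝ d)⟫_ℝ) *
          ({v : EuclideanSpace ℝ d | ‖v - (p.1.1 i).2‖ ≤ V}.indicator (fun _ => (1 : ℝ≥0∞)) p.1.2 *
            (E.indicator (fun _ => (1 : ℝ≥0∞)) (freeFlight G (-p.2.2) (gainConfig G ε p.1.1 i p.2.1 p.1.2)) *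
              ENNReal.ofReal (K p.2.2 (lossConfig G ε p.1.1 i p.2.1 p.1.2)))))) ?_
    -- measurability of the `ℝ≥0∞` integrand: it is `ofReal` of a measurable real function
    have hm : Measurable fun p : (Config n d (UnitAddTorus d) × EuclideanSpace ℝ d) × (sphere (0 : EuclideanSpace ℝ d) 1 × ℝ) =>
        ENNReal.ofReal (ε ^ (Fintype.card d - 1) * max ⟪p.1.2 - (p.1.1 i).2, (p.2.1 : EuclideanSpace ℝ d)⟫_ℝ 0 *
          {v : EuclideanSpace ℝ d | ‖v - (p.1.1 i).2‖ ≤ V}.indicator (1 : EuclideanSpace ℝ d → ℝ) p.1.2 *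
          E.indicator (1 : Config (n + 1) d (UnitAddTorus d) → ℝ) (freeFlight G (-p.2.2) (gainConfig G ε p.1.1 i p.2.1 p.1.2)) *
          K p.2.2 (lossConfig G ε p.1.1 i p.2.1 p.1.2)) :=
      ENNReal.measurable_ofReal.comp (((hflux.mul hslowm).mul hEind).mul (hHK K hK))
    simp_rw [hofReal K] at hm
    exact hm
  -- finiteness on the event side
  have hfin : ∀ (K : ℝ → Config (n + 1) d (UnitAddTorus d) → ℝ), (∀ τ w, |K τ w| = |H τ w|) →
      ∫⁻ z, ENNReal.ofReal (E.indicator (fun z => Sl.indicator (fun z => K (t₁ z) (outRep G n i (freeFlight G (t₁ z) z))) z) z) < ∞ := by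
    intro K hK
    refine lt_of_le_of_lt (lintegral_mono fun z => ?_) hint.2
    rw [Real.enorm_eq_ofReal_abs]
    refine ENNReal.ofReal_le_ofReal ?_
    simp only [hf]
    by_cases hz : z ∈ E
    · rw [indicator_of_mem hz, indicator_of_mem hz]
      by_cases hs : z ∈ Sl
      · rw [indicator_of_mem hs, indicator_of_mem hs, ← hK]; exact le_abs_self _
      · rw [indicator_of_notMem hs, indicator_of_notMem hs, abs_zero]
    · rw [indicator_of_notMem hz, indicator_of_notMem hz, abs_zero]
  -- `-f` and `-g`
  have hnegf : ∀ z, -f z = E.indicator (fun z => Sl.indicator (fun z => (-H) (t₁ z) (outRep G n i (freeFlight G (t₁ z) z))) z) z := by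
    intro z
    simp only [hf, Pi.neg_apply]
    by_cases hz : z ∈ E
    · rw [indicator_of_mem hz, indicator_of_mem hz]
      by_cases hs : z ∈ Sl
      · rw [indicator_of_mem hs, indicator_of_mem hs]
      · rw [indicator_of_notMem hs, indicator_of_notMem hs, neg_zero]
    · rw [indicator_of_notMem hz, indicator_of_notMem hz, neg_zero]
  have hnegg : ∀ p, -g p = ε ^ (Fintype.card d - 1) * max ⟪p.1.2 - (p.1.1 i).2, (p.2.1 : EuclideanSpace ℝ d)⟫_ℝ 0 *
      {v : EuclideanSpace ℝ d | ‖v - (p.1.1 i).2‖ ≤ V}.indicator (1 : EuclideanSpace ℝ d → ℝ) p.1.2 *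
      E.indicator (1 : Config (n + 1) d (UnitAddTorus d) → ℝ) (freeFlight G (-p.2.2) (gainConfig G ε p.1.1 i p.2.1 p.1.2)) *
      (-H) p.2.2 (lossConfig G ε p.1.1 i p.2.1 p.1.2) := by
    intro p; simp only [hg, Pi.neg_apply]; ring
  have hHneg : Measurable fun p : ℝ × Config (n + 1) d (UnitAddTorus d) => (-H) p.1 p.2 := hH.neg
  have hpos := hcore H hH
  have hneg := hcore (-H) hHneg
  -- the two `ℝ≥0∞` identities in terms of `f` and `g`
  have e1 : ∫⁻ z, ENNReal.ofReal (f z) = ∫⁻ p, ENNReal.ofReal (g p) ∂μP := by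
    simp only [hf, hg]; exact hpos
  have e2 : ∫⁻ z, ENNReal.ofReal (-f z) = ∫⁻ p, ENNReal.ofReal (-g p) ∂μP := by
    simp_rw [hnegf, hnegg]; exact hneg
  have hfinpos : ∫⁻ z, ENNReal.ofReal (f z) < ∞ := by
    have := hfin H (fun _ _ => rfl); simpa [hf] using this
  have hfinneg : ∫⁻ z, ENNReal.ofReal (-f z) < ∞ := by
    simp_rw [hnegf]; exact hfin (-H) (fun τ w => by simp [abs_neg])
  -- integrability of `g`
  have hgi : Integrable g μP := by
    refine ⟨hgm.aestronglyMeasurable, ?_⟩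
    show ∫⁻ p, ‖g p‖ₑ ∂μP < ∞
    have hsplit : ∀ p, ‖g p‖ₑ = ENNReal.ofReal (g p) + ENNReal.ofReal (-g p) := by
      intro p
      rw [Real.enorm_eq_ofReal_abs]
      rcases le_total 0 (g p) with h | h
      · rw [abs_of_nonneg h, ENNReal.ofReal_of_nonpos (neg_nonpos.2 h), add_zero]
      · rw [abs_of_nonpos h, ENNReal.ofReal_of_nonpos h, zero_add]
    simp_rw [hsplit]
    rw [lintegral_add_left (show Measurable fun p => ENNReal.ofReal (g p) from ENNReal.measurable_ofReal.comp hgm), ← e1, ← e2]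
    exact ENNReal.add_lt_top.2 ⟨hfinpos, hfinneg⟩
  refine ⟨hgi, ?_⟩
  rw [integral_eq_lintegral_pos_part_sub_lintegral_neg_part hint, integral_eq_lintegral_pos_part_sub_lintegral_neg_part hgi, e1, e2]

end GeneralIndex

section Bracket

variable {ε : ℝ} (hε : 0 < ε) (hε' : ε < 2⁻¹)

include hε hε' in
/-- The regularised flow is a group action on all of phase space, so
`Φ_s y ∈ Φ_t(B) ↔ y ∈ Φ_{t-s}(B)`. [folklore] -/
theorem regFlow_mem_image_iff {k : ℕ} (s t : ℝ) (B : Set (Config k d (UnitAddTorus d))) (y : Config k d (UnitAddTorus d)) :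
    Alexander.regFlow (Torus.geometry d) ε s y ∈ Alexander.regFlow (Torus.geometry d) ε t '' B ↔
      y ∈ Alexander.regFlow (Torus.geometry d) ε (t - s) '' B := by
  constructor
  · rintro ⟨b, hb, hby⟩
    refine ⟨b, hb, ?_⟩
    have := congrArg (Alexander.regFlow (Torus.geometry d) ε (-s)) hby
    rwa [← Alexander.regFlow_add hε hε', ← Alexander.regFlow_add hε hε', neg_add_cancel, Alexander.regFlow_zero hε hε',
      neg_add_eq_sub] at this
  · rintro ⟨b, hb, hby⟩
    refine ⟨b, hb, ?_⟩
    rw [← hby, ← Alexander.regFlow_add hε hε', add_sub_cancel]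

include hε hε' in
/-- **The window bracket on the single-collision event.** Let `z` belong to the single-collision
event of the window `(0, δ]` for a tagged sphere `I = castAdd i₀` and an untagged one `L`, with
collision instant `t₁`, incoming configuration `w_in = S_{t₁} z` and outgoing one
`w_out = collidePair I L w_in`, tagged blocks `y_in`, `y_out`. If the regularised tagged flow of
`y_out` is free on `[0, δ]` and that of `y_in` is free backwards on `[0, δ]`, then for every `a` and
every `B`, `1_{Φ^k_{a+δ} B}(π Φ_δ z) - 1_{Φ^k_a B}(π z) = 1_{Φ^k_{a+t₁} B}(y_out) - 1_{Φ^k_{a+t₁} B}(y_in)`: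
along the window the tagged block moves freely except for the jump `y_in → y_out` at `t₁`
(`singleCollisionEvent_structure`), and the regularised tagged flow is a group action
(`regFlow_mem_image_iff`). [cite: CIP1994, §4.3 (3.5] -/
theorem bracket_of_mem_singleCollisionEvent {k m : ℕ} {I L : Fin (k + m)} (hIL : I ≠ L) {δ : ℝ}
    {z : Config (k + m) d (UnitAddTorus d)}
    (hz : z ∈ Alexander.singleCollisionEvent (Torus.geometry d) ε I L δ)
    (hG1 : ∀ u ∈ Icc 0 δ, Alexander.regFlow (Torus.geometry d) ε u
        (collidePair (Torus.geometry d) I L (freeFlight (Torus.geometry d) (Alexander.collisionInstant (Torus.geometry d) ε z 1).toReal z) ∘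
          Fin.castAdd m : Config k d (UnitAddTorus d)) =
      freeFlight (Torus.geometry d) u
        (collidePair (Torus.geometry d) I L (freeFlight (Torus.geometry d) (Alexander.collisionInstant (Torus.geometry d) ε z 1).toReal z) ∘
          Fin.castAdd m : Config k d (UnitAddTorus d)))
    (hG2 : ∀ u ∈ Icc 0 δ, Alexander.regFlow (Torus.geometry d) ε (-u)
        (freeFlight (Torus.geometry d) (Alexander.collisionInstant (Torus.geometry d) ε z 1).toReal z ∘ Fin.castAdd m : Config k d (UnitAddTorus d)) =
      freeFlight (Torus.geometry d) (-u)
        (freeFlight (Torus.geometry d) (Alexander.collisionInstant (Torus.geometry d) ε z 1).toReal z ∘ Fin.castAdd m : Config k d (UnitAddTorus d)))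
    (a : ℝ) (B : Set (Config k d (UnitAddTorus d))) :
    (Alexander.regFlow (Torus.geometry d) ε (a + δ) '' B).indicator (1 : Config k d (UnitAddTorus d) → ℝ)
        (Alexander.regFlow (Torus.geometry d) ε δ z ∘ Fin.castAdd m : Config k d (UnitAddTorus d)) -
      (Alexander.regFlow (Torus.geometry d) ε a '' B).indicator (1 : Config k d (UnitAddTorus d) → ℝ) (z ∘ Fin.castAdd m : Config k d (UnitAddTorus d)) =
    (Alexander.regFlow (Torus.geometry d) ε (a + (Alexander.collisionInstant (Torus.geometry d) ε z 1).toReal) '' B).indicator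
        (1 : Config k d (UnitAddTorus d) → ℝ)
        (collidePair (Torus.geometry d) I L (freeFlight (Torus.geometry d) (Alexander.collisionInstant (Torus.geometry d) ε z 1).toReal z) ∘
          Fin.castAdd m : Config k d (UnitAddTorus d)) -
      (Alexander.regFlow (Torus.geometry d) ε (a + (Alexander.collisionInstant (Torus.geometry d) ε z 1).toReal) '' B).indicator
        (1 : Config k d (UnitAddTorus d) → ℝ)
        (freeFlight (Torus.geometry d) (Alexander.collisionInstant (Torus.geometry d) ε z 1).toReal z ∘ Fin.castAdd m : Config k d (UnitAddTorus d)) := by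
  have hG := Torus.isHardSphereRegular_geometry (d := d) hε'
  set t₁ := (Alexander.collisionInstant (Torus.geometry d) ε z 1).toReal with ht₁
  set w_in := freeFlight (Torus.geometry d) t₁ z with hw_in
  set w_out := collidePair (Torus.geometry d) I L w_in with hw_out
  obtain ⟨hτpos, hτle, -, -, hflow⟩ := Alexander.singleCollisionEvent_structure hG hIL hz
  have hzg := hz.1
  have hδ0 : 0 ≤ δ := hτpos.le.trans hτle
  -- the big flow at time `δ`
  have hbig : Alexander.regFlow (Torus.geometry d) ε δ z = freeFlight (Torus.geometry d) (δ - t₁) w_out := by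
    rw [Alexander.regFlow_of_mem hzg, hflow]
  -- the tagged blocks
  have hout : (Alexander.regFlow (Torus.geometry d) ε δ z ∘ Fin.castAdd m : Config k d (UnitAddTorus d)) =
      Alexander.regFlow (Torus.geometry d) ε (δ - t₁) (w_out ∘ Fin.castAdd m : Config k d (UnitAddTorus d)) := by
    rw [hbig, freeFlight_comp_castAdd, hG1 (δ - t₁) ⟨sub_nonneg.2 hτle, sub_le_self _ hτpos.le⟩]
  have hin : (z ∘ Fin.castAdd m : Config k d (UnitAddTorus d)) =
      Alexander.regFlow (Torus.geometry d) ε (-t₁) (w_in ∘ Fin.castAdd m : Config k d (UnitAddTorus d)) := by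
    rw [hG2 t₁ ⟨hτpos.le, hτle⟩, ← freeFlight_comp_castAdd, hw_in, ← freeFlight_add, neg_add_cancel, freeFlight_zero]
  rw [hout, hin]
  -- the group action
  have h1 : Alexander.regFlow (Torus.geometry d) ε (δ - t₁) (w_out ∘ Fin.castAdd m : Config k d (UnitAddTorus d)) ∈
      Alexander.regFlow (Torus.geometry d) ε (a + δ) '' B ↔
      (w_out ∘ Fin.castAdd m : Config k d (UnitAddTorus d)) ∈ Alexander.regFlow (Torus.geometry d) ε (a + t₁) '' B := by
    rw [regFlow_mem_image_iff hε hε', show a + δ - (δ - t₁) = a + t₁ by ring]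
  have h2 : Alexander.regFlow (Torus.geometry d) ε (-t₁) (w_in ∘ Fin.castAdd m : Config k d (UnitAddTorus d)) ∈
      Alexander.regFlow (Torus.geometry d) ε a '' B ↔
      (w_in ∘ Fin.castAdd m : Config k d (UnitAddTorus d)) ∈ Alexander.regFlow (Torus.geometry d) ε (a + t₁) '' B := by
    rw [regFlow_mem_image_iff hε hε', show a - -t₁ = a + t₁ by ring]
  congr 1
  · by_cases h : (w_out ∘ Fin.castAdd m : Config k d (UnitAddTorus d)) ∈ Alexander.regFlow (Torus.geometry d) ε (a + t₁) '' B
    · rw [indicator_of_mem h, indicator_of_mem (h1.2 h), Pi.one_apply, Pi.one_apply]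
    · rw [indicator_of_notMem h, indicator_of_notMem (fun h' => h (h1.1 h'))]
  · by_cases h : (w_in ∘ Fin.castAdd m : Config k d (UnitAddTorus d)) ∈ Alexander.regFlow (Torus.geometry d) ε (a + t₁) '' B
    · rw [indicator_of_mem h, indicator_of_mem (h2.2 h), Pi.one_apply, Pi.one_apply]
    · rw [indicator_of_notMem h, indicator_of_notMem (fun h' => h (h2.1 h'))]


/-- Before its first exit time a good datum moves freely under the regularised flow. [folklore] -/
theorem regFlow_eq_freeFlight_of_lt {N : ℕ} {y : Config N d (UnitAddTorus d)} (hy : y ∈ Alexander.good (Torus.geometry d) ε)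
    {u : ℝ} (hu : 0 ≤ u) (hlt : ENNReal.ofReal u < Alexander.freeExitTime (Torus.geometry d) ε y) :
    Alexander.regFlow (Torus.geometry d) ε u y = freeFlight (Torus.geometry d) u y := by
  rw [Alexander.regFlow_of_mem hy, Alexander.flow_of_nonneg hu, Alexander.fwdFlow_eq_freeFlight_of_lt hlt]

include hε hε' in
/-- Backwards, up to the first exit time of the velocity-flipped datum, a good datum moves freely
under the regularised flow. [folklore] -/
theorem regFlow_neg_eq_freeFlight_of_le {N : ℕ} {y : Config N d (UnitAddTorus d)} (hy : y ∈ Alexander.good (Torus.geometry d) ε)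
    {u : ℝ} (hu : 0 ≤ u) (hle : ENNReal.ofReal u ≤ Alexander.freeExitTime (Torus.geometry d) ε (flipVel y)) :
    Alexander.regFlow (Torus.geometry d) ε (-u) y = freeFlight (Torus.geometry d) (-u) y := by
  rcases hu.eq_or_lt with rfl | hu0
  · rw [neg_zero, Alexander.regFlow_zero hε hε', freeFlight_zero]
  · rw [Alexander.regFlow_of_mem hy, Alexander.flow_of_neg (neg_neg_of_pos hu0), neg_neg,
      Alexander.fwdFlowLeft_eq_freeFlight_of_le hle, Alexander.flipVel_freeFlight_flipVel]

include hε' in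
/-- **On the single-collision event the flow at the collision instant is the outgoing collision
configuration**: `Φ_{t₁} z = collidePair I L (S_{t₁} z)` (the state after the first collision,
`fwdFlow_collisionInstant`, resolved at the simple incoming exit configuration, up to the order
of the pair). [folklore] -/
theorem regFlow_collisionInstant_eq_of_mem {N : ℕ} {I L : Fin N} (hIL : I ≠ L) {δ : ℝ} {z : Config N d (UnitAddTorus d)}
    (hz : z ∈ Alexander.singleCollisionEvent (Torus.geometry d) ε I L δ) :
    Alexander.regFlow (Torus.geometry d) ε (Alexander.collisionInstant (Torus.geometry d) ε z 1).toReal z =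
      collidePair (Torus.geometry d) I L (freeFlight (Torus.geometry d) (Alexander.collisionInstant (Torus.geometry d) ε z 1).toReal z) := by
  have hG := Torus.isHardSphereRegular_geometry (d := d) hε'
  obtain ⟨hzg, h1, h2, hc⟩ := hz
  have hgood : Alexander.FwdGood (Torus.geometry d) ε z := hzg.2.2.1
  have hτ1 : Alexander.collisionInstant (Torus.geometry d) ε z 1 = Alexander.freeExitTime (Torus.geometry d) ε z :=
    Alexander.collisionInstant_one z
  have hfin : Alexander.collisionInstant (Torus.geometry d) ε z 1 ≠ ∞ := ne_top_of_le_ne_top ENNReal.ofReal_ne_top h1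
  rw [Alexander.regFlow_of_mem hzg, Alexander.flow_of_nonneg ENNReal.toReal_nonneg,
    hgood.fwdFlow_collisionInstant hG hfin (Or.inl Nat.one_pos)]
  have hexit : Alexander.freeExitTime (Torus.geometry d) ε (Alexander.stateAfter (Torus.geometry d) ε z 0) ≠ ∞ := by
    rwa [Alexander.stateAfter_zero, ← hτ1]
  obtain ⟨p, hp, hstate⟩ := hgood.exists_stateAfter_succ hexit
  rw [Alexander.stateAfter_zero, ← hτ1] at hp hstate
  rw [zero_add] at hstate
  rw [hstate]
  rcases hp.eq_or_eq_of_mem_contactSet hIL hc with ⟨h1', h2'⟩ | ⟨h1', h2'⟩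
  · rw [h1', h2']
  · rw [h1', h2']
    exact (hG.collidePair_comm hp.ne (le_of_eq hp.mem_contactSet.2)).symm


include hε hε' in
/-- `y ∈ Φ_t(B) ↔ Φ_{-t} y ∈ B` for the regularised flow (a group action on all of phase space).
[folklore] -/
theorem mem_image_regFlow_iff {k : ℕ} (t : ℝ) (B : Set (Config k d (UnitAddTorus d))) (y : Config k d (UnitAddTorus d)) :
    y ∈ Alexander.regFlow (Torus.geometry d) ε t '' B ↔ Alexander.regFlow (Torus.geometry d) ε (-t) y ∈ B := by
  have h := regFlow_mem_image_iff hε hε' (-t) (0 : ℝ) B y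
  rw [zero_sub, neg_neg] at h
  have h0 : Alexander.regFlow (Torus.geometry d) ε 0 '' B = B := by
    rw [Set.image_congr fun b _ => Alexander.regFlow_zero hε hε' b, Set.image_id']
  rw [h0] at h
  exact h.symm

include hε hε' in
/-- **The regularised flow preserves Lebesgue measure on all of phase space**: Liouville measure on
the domain (`measurePreserving_regFlow`) and the identity off the good set. [folklore] -/
theorem measurePreserving_regFlow_volume {N : ℕ} (t : ℝ) :
    MeasurePreserving (Alexander.regFlow (Torus.geometry d) ε t) (volume : Measure (Config N d (UnitAddTorus d))) volume := by
  have hD := measurableSet_hardSphereDomain (Torus.geometry d) Torus.measurable_geometry_sepVec N ε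
  refine ⟨Alexander.measurable_regFlow hε' t, ?_⟩
  have hsplit : (volume : Measure (Config N d (UnitAddTorus d))) =
      volume.restrict (hardSphereDomain (Torus.geometry d) N ε) + volume.restrict (hardSphereDomain (Torus.geometry d) N ε)ᶜ :=
    (Measure.restrict_add_restrict_compl hD).symm
  have h1 : Measure.map (Alexander.regFlow (Torus.geometry d) ε t) (volume.restrict (hardSphereDomain (Torus.geometry d) N ε)) =
      volume.restrict (hardSphereDomain (Torus.geometry d) N ε) := by
    have := (Alexander.measurePreserving_regFlow (d := d) (N := N) hε hε' t).map_eq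
    rwa [liouville_eq] at this
  have h2 : Measure.map (Alexander.regFlow (Torus.geometry d) ε t) (volume.restrict (hardSphereDomain (Torus.geometry d) N ε)ᶜ) =
      volume.restrict (hardSphereDomain (Torus.geometry d) N ε)ᶜ := by
    have hae : (Alexander.regFlow (Torus.geometry d) ε t : Config N d (UnitAddTorus d) → Config N d (UnitAddTorus d)) =ᵐ[
        volume.restrict (hardSphereDomain (Torus.geometry d) N ε)ᶜ] id := by
      rw [Filter.EventuallyEq, ae_restrict_iff' hD.compl]
      refine Filter.Eventually.of_forall fun z hz => ?_
      exact Alexander.regFlow_of_not_mem (fun h => hz (Alexander.good_subset_hardSphereDomain h)) t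
    rw [Measure.map_congr hae, Measure.map_id]
  conv_lhs => rw [hsplit]
  rw [Measure.map_add _ _ (Alexander.measurable_regFlow hε' t), h1, h2, ← hsplit]

end Bracket

section Classify

variable {ε : ℝ} (hε : 0 < ε) (hε' : ε < 2⁻¹)

include hε' in
/-- The single-collision event is symmetric in the pair (contact is symmetric in a regular
geometry). [folklore] -/
theorem singleCollisionEvent_comm {N : ℕ} (I J : Fin N) (δ : ℝ) :
    Alexander.singleCollisionEvent (Torus.geometry d) ε I J δ =
      Alexander.singleCollisionEvent (Torus.geometry d) ε J I δ (N := N) := by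
  have hG := Torus.isHardSphereRegular_geometry (d := d) hε'
  ext z
  simp only [Alexander.mem_singleCollisionEvent, hG.mem_contactSet_comm (i := I) (j := J)]

include hε' in
/-- **The single-collision events of distinct tagged–untagged pairs are disjoint**: the first exit
configuration of a good datum is a simple collision configuration, whose only contact pair is the
colliding one. [folklore] -/
theorem eq_of_mem_singleCollisionEvent {k m : ℕ} {i i' : Fin k} {J J' : Fin m} {δ : ℝ}
    {z : Config (k + m) d (UnitAddTorus d)}
    (hz : z ∈ Alexander.singleCollisionEvent (Torus.geometry d) ε (Fin.castAdd m i) (Fin.natAdd k J) δ)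
    (hz' : z ∈ Alexander.singleCollisionEvent (Torus.geometry d) ε (Fin.castAdd m i') (Fin.natAdd k J') δ) :
    i = i' ∧ J = J' := by
  have hG := Torus.isHardSphereRegular_geometry (d := d) hε'
  have hne : (Fin.castAdd m i : Fin (k + m)) ≠ Fin.natAdd k J := by
    intro h; have := congrArg Fin.val h; simp at this; omega
  obtain ⟨-, -, ⟨p, hp, -⟩, -, -⟩ := Alexander.singleCollisionEvent_structure hG hne hz
  have hne' : (Fin.castAdd m i' : Fin (k + m)) ≠ Fin.natAdd k J' := by
    intro h; have := congrArg Fin.val h; simp at this; omega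
  have h1 := hp.eq_or_eq_of_mem_contactSet hne hz.2.2.2
  have h2 := hp.eq_or_eq_of_mem_contactSet hne' hz'.2.2.2
  -- compare values: tagged indices are `< k`, untagged ones `≥ k`
  have hvi : (Fin.castAdd m i : Fin (k + m)).val = i.val := by simp
  have hvi' : (Fin.castAdd m i' : Fin (k + m)).val = i'.val := by simp
  have hvJ : (Fin.natAdd k J : Fin (k + m)).val = k + J.val := by simp
  have hvJ' : (Fin.natAdd k J' : Fin (k + m)).val = k + J'.val := by simp
  rcases h1 with ⟨ha, hb⟩ | ⟨ha, hb⟩ <;> rcases h2 with ⟨ha', hb'⟩ | ⟨ha', hb'⟩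
  · have e1 := congrArg Fin.val (ha.trans ha'.symm); have e2 := congrArg Fin.val (hb.trans hb'.symm)
    rw [hvi, hvi'] at e1; rw [hvJ, hvJ'] at e2
    exact ⟨Fin.ext e1, Fin.ext (by omega)⟩
  · have e1 := congrArg Fin.val (ha.trans hb'.symm); rw [hvi, hvJ'] at e1
    have := i.isLt; omega
  · have e1 := congrArg Fin.val (hb.trans ha'.symm); rw [hvJ, hvi'] at e1
    have := i'.isLt; omega
  · have e1 := congrArg Fin.val (hb.trans hb'.symm); have e2 := congrArg Fin.val (ha.trans ha'.symm)
    rw [hvJ, hvJ'] at e1; rw [hvi, hvi'] at e2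
    exact ⟨Fin.ext e2, Fin.ext (by omega)⟩

include hε hε' in
/-- **Classification of the windows** (pointwise, CIP 1994 App. 4.A Steps 1–2). For a good datum
`z₀` of the big system, a window `[a, a + δ]` (`0 ≤ a`, `0 < δ`) and a set `B` of good tagged
configurations, the increment over the window of `1_{Φ^k_t B}(π Φ_t z₀)` is its restriction to the
single-collision events of the tagged–untagged pairs (evaluated at `Φ_a z₀`), up to a remainder
supported in the data whose tagged block at time `a` is not good or whose orbit has at least two
collision instants in `(a, a + δ]`, and bounded by `2` there (no tagged–untagged contact in the
window ⇒ no increment, `abs_indicator_sub_le`; a contact outside the events ⇒ two instants,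
`two_le_collisionCount_sub_of_contact`; the events are disjoint,
`eq_of_mem_singleCollisionEvent`). [cite: CIP1994, App. 4.A] -/
theorem abs_increment_sub_sum_le [DecidableEq d] {k m : ℕ} {B : Set (Config k d (UnitAddTorus d))}
    (hBg : B ⊆ Alexander.good (Torus.geometry d) ε)
    {z₀ : Config (k + m) d (UnitAddTorus d)} (hz₀ : z₀ ∈ Alexander.good (Torus.geometry d) ε)
    {a δ : ℝ} (ha : 0 ≤ a) (hδ : 0 < δ) :
    |((Alexander.regFlow (Torus.geometry d) ε (a + δ) '' B).indicator (1 : Config k d (UnitAddTorus d) → ℝ)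
          (Alexander.regFlow (Torus.geometry d) ε (a + δ) z₀ ∘ Fin.castAdd m) -
        (Alexander.regFlow (Torus.geometry d) ε a '' B).indicator (1 : Config k d (UnitAddTorus d) → ℝ)
          (Alexander.regFlow (Torus.geometry d) ε a z₀ ∘ Fin.castAdd m)) -
      ∑ p : Fin k × Fin m,
        (Alexander.singleCollisionEvent (Torus.geometry d) ε (Fin.castAdd m p.1) (Fin.natAdd k p.2) δ).indicator
          (1 : Config (k + m) d (UnitAddTorus d) → ℝ) (Alexander.regFlow (Torus.geometry d) ε a z₀) *
        ((Alexander.regFlow (Torus.geometry d) ε (a + δ) '' B).indicator (1 : Config k d (UnitAddTorus d) → ℝ)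
            (Alexander.regFlow (Torus.geometry d) ε (a + δ) z₀ ∘ Fin.castAdd m) -
          (Alexander.regFlow (Torus.geometry d) ε a '' B).indicator (1 : Config k d (UnitAddTorus d) → ℝ)
            (Alexander.regFlow (Torus.geometry d) ε a z₀ ∘ Fin.castAdd m))| ≤
      2 * ({z₀ : Config (k + m) d (UnitAddTorus d) |
              (Alexander.regFlow (Torus.geometry d) ε a z₀ ∘ Fin.castAdd m : Config k d (UnitAddTorus d)) ∉
                Alexander.good (Torus.geometry d) ε}.indicator 1 z₀ +
            {z₀ : Config (k + m) d (UnitAddTorus d) |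
              Alexander.collisionCount (Torus.geometry d) ε z₀ a + 2 ≤ Alexander.collisionCount (Torus.geometry d) ε z₀ (a + δ)}.indicator 1 z₀) := by
  classical
  have hG := Torus.isHardSphereRegular_geometry (d := d) hε'
  set Φk := Alexander.regHardSphereFlow (d := d) hε hε' k with hΦk
  set ΦN := Alexander.regHardSphereFlow (d := d) hε hε' (k + m) with hΦN
  set Δ := (Alexander.regFlow (Torus.geometry d) ε (a + δ) '' B).indicator (1 : Config k d (UnitAddTorus d) → ℝ)
          (Alexander.regFlow (Torus.geometry d) ε (a + δ) z₀ ∘ Fin.castAdd m) -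
        (Alexander.regFlow (Torus.geometry d) ε a '' B).indicator (1 : Config k d (UnitAddTorus d) → ℝ)
          (Alexander.regFlow (Torus.geometry d) ε a z₀ ∘ Fin.castAdd m) with hΔ
  set z := Alexander.regFlow (Torus.geometry d) ε a z₀ with hzdef
  have hza : z = Alexander.fwdFlow (Torus.geometry d) ε z₀ a := by
    rw [hzdef, Alexander.regFlow_of_mem hz₀, Alexander.flow_of_nonneg ha]
  -- bounds on the indicators
  have hind : ∀ (S : Set (Config k d (UnitAddTorus d))) (y : Config k d (UnitAddTorus d)),
      0 ≤ S.indicator (1 : Config k d (UnitAddTorus d) → ℝ) y ∧ S.indicator (1 : Config k d (UnitAddTorus d) → ℝ) y ≤ 1 := by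
    intro S y
    by_cases h : y ∈ S
    · rw [indicator_of_mem h, Pi.one_apply]; exact ⟨zero_le_one, le_rfl⟩
    · rw [indicator_of_notMem h]; exact ⟨le_rfl, zero_le_one⟩
  have hΔle : |Δ| ≤ 2 := by
    rw [hΔ]
    have h1 := hind (Alexander.regFlow (Torus.geometry d) ε (a + δ) '' B) (Alexander.regFlow (Torus.geometry d) ε (a + δ) z₀ ∘ Fin.castAdd m)
    have h2 := hind (Alexander.regFlow (Torus.geometry d) ε a '' B) (Alexander.regFlow (Torus.geometry d) ε a z₀ ∘ Fin.castAdd m)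
    rw [abs_le]; constructor <;> linarith [h1.1, h1.2, h2.1, h2.2]
  by_cases hev : ∃ p : Fin k × Fin m, z ∈ Alexander.singleCollisionEvent (Torus.geometry d) ε (Fin.castAdd m p.1) (Fin.natAdd k p.2) δ
  · -- in exactly one event: the sum is `Δ`
    obtain ⟨p₀, hp₀⟩ := hev
    have hsum : ∑ p : Fin k × Fin m,
        (Alexander.singleCollisionEvent (Torus.geometry d) ε (Fin.castAdd m p.1) (Fin.natAdd k p.2) δ).indicator
          (1 : Config (k + m) d (UnitAddTorus d) → ℝ) z * Δ = Δ := by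
      rw [Finset.sum_eq_single p₀]
      · rw [indicator_of_mem hp₀, Pi.one_apply, one_mul]
      · intro p _ hp
        rw [indicator_of_notMem, zero_mul]
        intro hpz
        obtain ⟨h1, h2⟩ := eq_of_mem_singleCollisionEvent hε' hpz hp₀
        exact hp (Prod.ext h1 h2)
      · intro h; exact absurd (Finset.mem_univ p₀) h
    rw [hsum, sub_self, abs_zero]
    exact mul_nonneg zero_le_two (add_nonneg (Set.indicator_nonneg (fun _ _ => zero_le_one) _)
      (Set.indicator_nonneg (fun _ _ => zero_le_one) _))
  · -- in no event: the sum vanishes and `Δ` is controlled by the classification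
    push Not at hev
    have hsum : ∑ p : Fin k × Fin m,
        (Alexander.singleCollisionEvent (Torus.geometry d) ε (Fin.castAdd m p.1) (Fin.natAdd k p.2) δ).indicator
          (1 : Config (k + m) d (UnitAddTorus d) → ℝ) z * Δ = 0 := by
      refine Finset.sum_eq_zero fun p _ => ?_
      rw [indicator_of_notMem (hev p), zero_mul]
    rw [hsum, sub_zero]
    -- class (i): no tagged–untagged contact in the window and good tagged block ⇒ `Δ = 0`
    have hcls := abs_indicator_sub_le Φk ΦN (B := B) hBg (z₀ := z₀) hz₀ (t₁ := a) (t₂ := a + δ) (by linarith)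
    simp only [hΦk, hΦN, Alexander.regHardSphereFlow_flow, Alexander.regHardSphereFlow_good] at hcls
    by_cases hng : (Alexander.regFlow (Torus.geometry d) ε a z₀ ∘ Fin.castAdd m : Config k d (UnitAddTorus d)) ∉
        Alexander.good (Torus.geometry d) ε
    · have h1 : ({z₀ : Config (k + m) d (UnitAddTorus d) |
          (Alexander.regFlow (Torus.geometry d) ε a z₀ ∘ Fin.castAdd m : Config k d (UnitAddTorus d)) ∉
            Alexander.good (Torus.geometry d) ε}).indicator (1 : Config (k + m) d (UnitAddTorus d) → ℝ) z₀ = 1 :=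
        by rw [indicator_of_mem (by exact hng), Pi.one_apply]
      rw [h1]
      have h2 := (hind ∅ (z₀ ∘ Fin.castAdd m)).1
      have h3 : 0 ≤ ({z₀ : Config (k + m) d (UnitAddTorus d) |
          Alexander.collisionCount (Torus.geometry d) ε z₀ a + 2 ≤ Alexander.collisionCount (Torus.geometry d) ε z₀ (a + δ)}).indicator
            (1 : Config (k + m) d (UnitAddTorus d) → ℝ) z₀ := by
        by_cases h : z₀ ∈ {z₀ : Config (k + m) d (UnitAddTorus d) |
            Alexander.collisionCount (Torus.geometry d) ε z₀ a + 2 ≤ Alexander.collisionCount (Torus.geometry d) ε z₀ (a + δ)}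
        · rw [indicator_of_mem h, Pi.one_apply]; exact zero_le_one
        · rw [indicator_of_notMem h]
      linarith [hΔle, abs_nonneg Δ]
    · push Not at hng
      rw [indicator_of_notMem (show z₀ ∉ {z₀ : Config (k + m) d (UnitAddTorus d) |
          (Alexander.regFlow (Torus.geometry d) ε a z₀ ∘ Fin.castAdd m : Config k d (UnitAddTorus d)) ∉
            Alexander.good (Torus.geometry d) ε} from fun h => h hng), zero_add] at hcls ⊢
      by_cases hcontact : ∃ τ ∈ Ioc a (a + δ), ∃ I J : Fin (k + m), I ≠ J ∧
          Alexander.regFlow (Torus.geometry d) ε τ z₀ ∈ contactSet (Torus.geometry d) (k + m) ε I J ∧ ¬((I : ℕ) < k ↔ (J : ℕ) < k)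
      · -- a tagged–untagged contact outside the events: a dirty window
        obtain ⟨τ, hτ, I, J, hIJ, hc, hmixed⟩ := hcontact
        have hτ0 : 0 ≤ τ := ha.trans hτ.1.le
        have hcf : Alexander.fwdFlow (Torus.geometry d) ε z₀ τ ∈ contactSet (Torus.geometry d) (k + m) ε I J := by
          rwa [Alexander.regFlow_of_mem hz₀, Alexander.flow_of_nonneg hτ0] at hc
        -- the pair as a tagged–untagged pair, in the right order
        have hnotev : Alexander.fwdFlow (Torus.geometry d) ε z₀ a ∉
            Alexander.singleCollisionEvent (Torus.geometry d) ε I J (a + δ - a) := by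
          rw [show a + δ - a = δ by ring, ← hza]
          intro hmem
          by_cases hI : (I : ℕ) < k
          · have hJ : ¬ (J : ℕ) < k := fun h => hmixed ⟨fun _ => h, fun _ => hI⟩
            push Not at hJ
            set i : Fin k := ⟨I, hI⟩
            set j : Fin m := ⟨J - k, by omega⟩
            have hIi : I = Fin.castAdd m i := Fin.ext (by simp [i])
            have hJj : J = Fin.natAdd k j := Fin.ext (by simp [j]; omega)
            rw [hIi, hJj] at hmem
            exact hev (i, j) hmem
          · have hJ : (J : ℕ) < k := by
              by_contra h; exact hmixed ⟨fun h' => absurd h' hI, fun h' => absurd h' h⟩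
            push Not at hI
            set i : Fin k := ⟨J, hJ⟩
            set j : Fin m := ⟨I - k, by omega⟩
            have hJi : J = Fin.castAdd m i := Fin.ext (by simp [i])
            have hIj : I = Fin.natAdd k j := Fin.ext (by simp [j]; omega)
            rw [singleCollisionEvent_comm hε', hJi, hIj] at hmem
            exact hev (i, j) hmem
        have hdirty := Alexander.two_le_collisionCount_sub_of_contact hG hz₀ ha (by linarith) hτ hIJ hcf hnotev
        rw [indicator_of_mem (show z₀ ∈ {z₀ : Config (k + m) d (UnitAddTorus d) |
            Alexander.collisionCount (Torus.geometry d) ε z₀ a + 2 ≤ Alexander.collisionCount (Torus.geometry d) ε z₀ (a + δ)} from hdirty),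
          Pi.one_apply]
        linarith [hΔle]
      · -- no tagged–untagged contact: no increment
        rw [indicator_of_notMem (show z₀ ∉ {z₀ : Config (k + m) d (UnitAddTorus d) | ∃ τ ∈ Ioc a (a + δ), ∃ I J : Fin (k + m), I ≠ J ∧
            Alexander.regFlow (Torus.geometry d) ε τ z₀ ∈ contactSet (Torus.geometry d) (k + m) ε I J ∧ ¬((I : ℕ) < k ↔ (J : ℕ) < k)}
            from hcontact), zero_mul] at hcls
        have hΔ0 : Δ = 0 := abs_nonpos_iff.1 hcls
        rw [hΔ0, abs_zero]
        exact mul_nonneg zero_le_two (Set.indicator_nonneg (fun _ _ => zero_le_one) _)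

end Classify

section Window

variable {ε : ℝ} (hε : 0 < ε) (hε' : ε < 2⁻¹)

include hε hε' in
/-- **The event terms in the coordinates of the window start** (Liouville). For a window
`[a, a + δ]`, an event `E` (any set) and a measurable weight `W`,
`∫_{good} 1_E(Φ_a z₀) (ψ_{a+δ}(Φ_{a+δ} z₀) - ψ_a(Φ_a z₀)) W(z₀) dz₀ = ∫_{good} 1_E(z) (ψ_{a+δ}(Φ_δ z) - ψ_a(z)) W(Φ_{-a} z) dz`
with `ψ_t = 1_{Φ^k_t B} ∘ π` (`HardSphereFlow.setIntegral_comp_flow` and the group law of the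
regularised flow). [folklore] -/
theorem setIntegral_event_increment_eq {k m : ℕ} (E : Set (Config (k + m) d (UnitAddTorus d))) (hE : MeasurableSet E)
    {B : Set (Config k d (UnitAddTorus d))} (hB : MeasurableSet B) (hBg : B ⊆ Alexander.good (Torus.geometry d) ε)
    {W : Config (k + m) d (UnitAddTorus d) → ℝ} (hW : Measurable W) (a δ : ℝ) :
    ∫ z₀ in Alexander.good (Torus.geometry d) ε,
        E.indicator (1 : Config (k + m) d (UnitAddTorus d) → ℝ) (Alexander.regFlow (Torus.geometry d) ε a z₀) *
          (((Alexander.regFlow (Torus.geometry d) ε (a + δ) '' B).indicator (1 : Config k d (UnitAddTorus d) → ℝ)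
              (Alexander.regFlow (Torus.geometry d) ε (a + δ) z₀ ∘ Fin.castAdd m) -
            (Alexander.regFlow (Torus.geometry d) ε a '' B).indicator (1 : Config k d (UnitAddTorus d) → ℝ)
              (Alexander.regFlow (Torus.geometry d) ε a z₀ ∘ Fin.castAdd m)) * W z₀) =
      ∫ z in Alexander.good (Torus.geometry d) ε,
        E.indicator (1 : Config (k + m) d (UnitAddTorus d) → ℝ) z *
          (((Alexander.regFlow (Torus.geometry d) ε (a + δ) '' B).indicator (1 : Config k d (UnitAddTorus d) → ℝ)
              (Alexander.regFlow (Torus.geometry d) ε δ z ∘ Fin.castAdd m) -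
            (Alexander.regFlow (Torus.geometry d) ε a '' B).indicator (1 : Config k d (UnitAddTorus d) → ℝ) (z ∘ Fin.castAdd m)) *
          W (Alexander.regFlow (Torus.geometry d) ε (-a) z)) := by
  set Φk := Alexander.regHardSphereFlow (d := d) hε hε' k with hΦk
  set ΦN := Alexander.regHardSphereFlow (d := d) hε hε' (k + m) with hΦN
  -- measurability of `g`
  have hπ : Measurable fun z : Config (k + m) d (UnitAddTorus d) => (z ∘ Fin.castAdd m : Config k d (UnitAddTorus d)) :=
    measurable_pi_lambda _ fun i => measurable_pi_apply _
  have himg : ∀ t : ℝ, MeasurableSet (Alexander.regFlow (Torus.geometry d) ε t '' B) := by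
    intro t
    have := Φk.measurableSet_image_flow t hB hBg
    simpa [hΦk] using this
  have hgm : Measurable fun z : Config (k + m) d (UnitAddTorus d) =>
      E.indicator (1 : Config (k + m) d (UnitAddTorus d) → ℝ) z *
        (((Alexander.regFlow (Torus.geometry d) ε (a + δ) '' B).indicator (1 : Config k d (UnitAddTorus d) → ℝ)
            (Alexander.regFlow (Torus.geometry d) ε δ z ∘ Fin.castAdd m) -
          (Alexander.regFlow (Torus.geometry d) ε a '' B).indicator (1 : Config k d (UnitAddTorus d) → ℝ) (z ∘ Fin.castAdd m)) *
        W (Alexander.regFlow (Torus.geometry d) ε (-a) z)) := by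
    refine Measurable.mul (measurable_const.indicator hE) (Measurable.mul (Measurable.sub ?_ ?_) (hW.comp (Alexander.measurable_regFlow hε' _)))
    · exact (measurable_const.indicator (himg _)).comp (hπ.comp (Alexander.measurable_regFlow hε' _))
    · exact (measurable_const.indicator (himg _)).comp hπ
  have key := ΦN.setIntegral_comp_flow a hgm
  simp only [hΦN, Alexander.regHardSphereFlow_flow, Alexander.regHardSphereFlow_good] at key
  rw [← key]
  refine setIntegral_congr_fun (Alexander.measurableSet_good (Torus.isHardSphereRegular_geometry hε') Torus.isMeasurable_geometry) fun z₀ _ => ?_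
  rw [← Alexander.regFlow_add hε hε', ← Alexander.regFlow_add hε hε', neg_add_cancel, Alexander.regFlow_zero hε hε', add_comm δ a]


include hε hε' in
/-- **Relabelling the collider in the Bochner integral over a single-collision event**
(`lintegral_singleCollisionEvent_comp_perm` for real integrands): for a permutation `σ`,
a measurable real `F`, `δ > 0` and `I ≠ J`,
`∫ 1_{E(σ I, σ J)}(z) F(z) dz = ∫ 1_{E(I, J)}(z) F(z ∘ σ⁻¹) dz`. [folklore] -/
theorem integral_singleCollisionEvent_comp_perm {N : ℕ} (σ : Equiv.Perm (Fin N)) {I J : Fin N} (hIJ : I ≠ J) {δ : ℝ} (hδ : 0 < δ)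
    (F : Config N d (UnitAddTorus d) → ℝ) :
    ∫ z, (Alexander.singleCollisionEvent (Torus.geometry d) ε (σ I) (σ J) δ).indicator (1 : Config N d (UnitAddTorus d) → ℝ) z * F z =
      ∫ z, (Alexander.singleCollisionEvent (Torus.geometry d) ε I J δ).indicator (1 : Config N d (UnitAddTorus d) → ℝ) z *
        F (z ∘ σ.symm : Config N d (UnitAddTorus d)) := by
  haveI hXE : SigmaFinite (volume : Measure (UnitAddTorus d × EuclideanSpace ℝ d)) := inferInstance
  have hG := Torus.isHardSphereRegular_geometry (d := d) hε'
  have hGm := Torus.isMeasurable_geometry (d := d)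
  set Φ := Alexander.regHardSphereFlow (d := d) hε hε' N with hΦ
  set e := MeasurableEquiv.piCongrLeft (fun _ : Fin N => UnitAddTorus d × EuclideanSpace ℝ d) σ.symm with hedef
  have he : (e : Config N d (UnitAddTorus d) → Config N d (UnitAddTorus d)) = fun z => (z ∘ σ : Config N d (UnitAddTorus d)) := by
    funext z i
    simp [hedef, MeasurableEquiv.coe_piCongrLeft, Equiv.piCongrLeft_apply_eq_cast]
  have hvol : MeasurePreserving e volume volume :=
    volume_measurePreserving_piCongrLeft (fun _ : Fin N => UnitAddTorus d × EuclideanSpace ℝ d) σ.symm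
  -- change of variables `z ↦ z ∘ σ` in the right-hand side
  have key := hvol.integral_comp e.measurableEmbedding
    (fun z : Config N d (UnitAddTorus d) => (Alexander.singleCollisionEvent (Torus.geometry d) ε I J δ).indicator
      (1 : Config N d (UnitAddTorus d) → ℝ) z * F (z ∘ σ.symm : Config N d (UnitAddTorus d)))
  rw [← key, he]
  -- the integrands agree almost everywhere
  have hgood : ∀ᵐ z : Config N d (UnitAddTorus d), z ∈ hardSphereDomain (Torus.geometry d) N ε →
      z ∈ Alexander.good (Torus.geometry d) ε := by
    have h := Φ.measure_compl_good
    rw [liouville_eq, Measure.restrict_apply' (measurableSet_hardSphereDomain _ Torus.measurable_geometry_sepVec N ε)] at h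
    have h' : ∀ᵐ z : Config N d (UnitAddTorus d), z ∉ Φ.goodᶜ ∩ hardSphereDomain (Torus.geometry d) N ε :=
      measure_eq_zero_iff_ae_notMem.1 h
    filter_upwards [h'] with z hz hzD
    by_contra hng
    exact hz ⟨hng, hzD⟩
  have hgoodσ : ∀ᵐ z : Config N d (UnitAddTorus d), z ∈ hardSphereDomain (Torus.geometry d) N ε →
      (z ∘ σ : Config N d (UnitAddTorus d)) ∈ Alexander.good (Torus.geometry d) ε := by
    have h := Φ.ae_comp_perm_mem_good σ
    rw [liouville_eq, ae_restrict_iff' (measurableSet_hardSphereDomain _ Torus.measurable_geometry_sepVec N ε)] at h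
    exact h
  refine integral_congr_ae ?_
  filter_upwards [hgood, hgoodσ] with z hz hzσ
  have hσσ : ((z ∘ σ) ∘ σ.symm : Config N d (UnitAddTorus d)) = z := by
    funext i; simp
  simp only [hσσ]
  by_cases hzD : z ∈ hardSphereDomain (Torus.geometry d) N ε
  · have hzg := hz hzD
    have hzσg := hzσ hzD
    by_cases hmem : z ∈ Alexander.singleCollisionEvent (Torus.geometry d) ε (σ I) (σ J) δ
    · rw [indicator_of_mem hmem, indicator_of_mem ((comp_perm_mem_singleCollisionEvent_iff hε hε' σ hzg hzσg hIJ hδ).2 hmem),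
        Pi.one_apply, Pi.one_apply]
    · rw [indicator_of_notMem hmem, indicator_of_notMem]
      exact fun h => hmem ((comp_perm_mem_singleCollisionEvent_iff hε hε' σ hzg hzσg hIJ hδ).1 h)
  · have h1 : z ∉ Alexander.singleCollisionEvent (Torus.geometry d) ε (σ I) (σ J) δ :=
      fun h => hzD (Alexander.good_subset_hardSphereDomain h.1)
    have h2 : (z ∘ σ : Config N d (UnitAddTorus d)) ∉ Alexander.singleCollisionEvent (Torus.geometry d) ε I J δ :=
      fun h => hzD ((perm_mem_hardSphereDomain_iff σ z).1 (Alexander.good_subset_hardSphereDomain h.1))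
    rw [indicator_of_notMem h1, indicator_of_notMem h2]


include hε hε' in
/-- **The event terms of all untagged colliders are equal** (relabelling `J ↔ last`): for a weight
`W` symmetric under the transposition of the untagged labels `J` and last, a window start
`a ≥ 0`, `δ > 0`, and a tagged label `i`, the event term of the pair (`i`, `J`) equals that of the
pair (`i`, last) (`integral_singleCollisionEvent_comp_perm`; the tagged block, the regularised
flow on good data and `W` are invariant). [folklore] -/
theorem event_term_relabel {k m' : ℕ} (i : Fin k) (J : Fin (m' + 1)) {a δ : ℝ} (ha : 0 ≤ a) (hδ : 0 < δ)
    (B : Set (Config k d (UnitAddTorus d))) {W : Config (k + (m' + 1)) d (UnitAddTorus d) → ℝ}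
    (hWσ : ∀ z : Config (k + (m' + 1)) d (UnitAddTorus d),
      W (z ∘ Equiv.swap (Fin.natAdd k J) (Fin.natAdd k (Fin.last m')) : Config (k + (m' + 1)) d (UnitAddTorus d)) = W z) :
    ∫ z, (Alexander.singleCollisionEvent (Torus.geometry d) ε (Fin.castAdd (m' + 1) i) (Fin.natAdd k J) δ).indicator
          (1 : Config (k + (m' + 1)) d (UnitAddTorus d) → ℝ) z *
        (((Alexander.regFlow (Torus.geometry d) ε (a + δ) '' B).indicator (1 : Config k d (UnitAddTorus d) → ℝ)
              (Alexander.regFlow (Torus.geometry d) ε δ z ∘ Fin.castAdd (m' + 1)) -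
            (Alexander.regFlow (Torus.geometry d) ε a '' B).indicator (1 : Config k d (UnitAddTorus d) → ℝ) (z ∘ Fin.castAdd (m' + 1))) *
          W (Alexander.regFlow (Torus.geometry d) ε (-a) z)) =
      ∫ z, (Alexander.singleCollisionEvent (Torus.geometry d) ε (Fin.castAdd (m' + 1) i) (Fin.natAdd k (Fin.last m')) δ).indicator
          (1 : Config (k + (m' + 1)) d (UnitAddTorus d) → ℝ) z *
        (((Alexander.regFlow (Torus.geometry d) ε (a + δ) '' B).indicator (1 : Config k d (UnitAddTorus d) → ℝ)
              (Alexander.regFlow (Torus.geometry d) ε δ z ∘ Fin.castAdd (m' + 1)) -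
            (Alexander.regFlow (Torus.geometry d) ε a '' B).indicator (1 : Config k d (UnitAddTorus d) → ℝ) (z ∘ Fin.castAdd (m' + 1))) *
          W (Alexander.regFlow (Torus.geometry d) ε (-a) z)) := by
  have hG := Torus.isHardSphereRegular_geometry (d := d) hε'
  have hGm := Torus.isMeasurable_geometry (d := d)
  set Φ := Alexander.regHardSphereFlow (d := d) hε hε' (k + (m' + 1)) with hΦ
  set σ : Equiv.Perm (Fin (k + (m' + 1))) := Equiv.swap (Fin.natAdd k J) (Fin.natAdd k (Fin.last m')) with hσ
  set I : Fin (k + (m' + 1)) := Fin.castAdd (m' + 1) i with hI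
  set L : Fin (k + (m' + 1)) := Fin.natAdd k (Fin.last m') with hL
  have hIJv : ∀ j : Fin k, ∀ J' : Fin (m' + 1), (Fin.castAdd (m' + 1) j : Fin (k + (m' + 1))) ≠ Fin.natAdd k J' := by
    intro j J' h; have := congrArg Fin.val h; simp at this; omega
  have hσtag : ∀ j : Fin k, σ (Fin.castAdd (m' + 1) j) = Fin.castAdd (m' + 1) j := fun j =>
    Equiv.swap_apply_of_ne_of_ne (hIJv j J) (hIJv j (Fin.last m'))
  have hσI : σ I = I := hσtag i
  have hσL : σ L = Fin.natAdd k J := by rw [hσ, hL, Equiv.swap_apply_right]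
  have hIL : I ≠ L := hIJv i (Fin.last m')
  have hσsymm : σ.symm = σ := by rw [hσ, Equiv.symm_swap]
  -- tagged blocks are invariant
  have htag : ∀ w : Config (k + (m' + 1)) d (UnitAddTorus d),
      ((w ∘ σ : Config (k + (m' + 1)) d (UnitAddTorus d)) ∘ Fin.castAdd (m' + 1) : Config k d (UnitAddTorus d)) = w ∘ Fin.castAdd (m' + 1) := by
    intro w; funext j; simp only [Function.comp_apply, hσtag j]
  -- relabel
  have hE : Alexander.singleCollisionEvent (Torus.geometry d) ε (Fin.castAdd (m' + 1) i) (Fin.natAdd k J) δ =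
      Alexander.singleCollisionEvent (Torus.geometry d) ε (σ I) (σ L) δ := by rw [hσI, hσL]
  rw [hE, integral_singleCollisionEvent_comp_perm hε hε' σ hIL hδ, hσsymm]
  -- the integrands agree almost everywhere
  have hgood : ∀ᵐ z : Config (k + (m' + 1)) d (UnitAddTorus d), z ∈ hardSphereDomain (Torus.geometry d) (k + (m' + 1)) ε →
      (z ∘ σ : Config (k + (m' + 1)) d (UnitAddTorus d)) ∈ Alexander.good (Torus.geometry d) ε := by
    have h := Φ.ae_comp_perm_mem_good σ
    rw [liouville_eq, ae_restrict_iff' (measurableSet_hardSphereDomain _ Torus.measurable_geometry_sepVec _ ε)] at h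
    exact h
  have hgoodback : ∀ᵐ z : Config (k + (m' + 1)) d (UnitAddTorus d), z ∈ hardSphereDomain (Torus.geometry d) (k + (m' + 1)) ε →
      (Alexander.regFlow (Torus.geometry d) ε (-a) z ∘ σ : Config (k + (m' + 1)) d (UnitAddTorus d)) ∈ Alexander.good (Torus.geometry d) ε := by
    have h := (Φ.measurePreserving (-a)).quasiMeasurePreserving.ae (Φ.ae_comp_perm_mem_good σ)
    rw [liouville_eq, ae_restrict_iff' (measurableSet_hardSphereDomain _ Torus.measurable_geometry_sepVec _ ε)] at h
    simpa [hΦ] using h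
  refine integral_congr_ae ?_
  filter_upwards [hgood, hgoodback] with z hzσ hzback
  by_cases hzE : z ∈ Alexander.singleCollisionEvent (Torus.geometry d) ε I L δ
  swap
  · rw [indicator_of_notMem hzE, zero_mul, zero_mul]
  have hzg : z ∈ Alexander.good (Torus.geometry d) ε := hzE.1
  have hzD : z ∈ hardSphereDomain (Torus.geometry d) (k + (m' + 1)) ε := Alexander.good_subset_hardSphereDomain hzg
  have hzσg := hzσ hzD
  -- the flow at time `δ`
  have hflowδ : Alexander.regFlow (Torus.geometry d) ε δ (z ∘ σ) = (Alexander.regFlow (Torus.geometry d) ε δ z ∘ σ : Config (k + (m' + 1)) d (UnitAddTorus d)) := by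
    have h := Φ.flow_comp_perm_of_nonneg σ (z := z) hzg hzσg hδ.le
    simpa [hΦ] using h
  -- the flow at time `-a`
  have hfloww : Alexander.regFlow (Torus.geometry d) ε (-a) (z ∘ σ) =
      (Alexander.regFlow (Torus.geometry d) ε (-a) z ∘ σ : Config (k + (m' + 1)) d (UnitAddTorus d)) := by
    set w := Alexander.regFlow (Torus.geometry d) ε (-a) z with hw
    have hwg : w ∈ Alexander.good (Torus.geometry d) ε := by
      have := Φ.mapsTo_good (-a) hzg
      simpa [hΦ] using this
    have hwσg := hzback hzD
    have h := Φ.flow_comp_perm_of_nonneg σ (z := w) hwg hwσg ha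
    simp only [hΦ, Alexander.regHardSphereFlow_flow] at h
    have hwz : Alexander.regFlow (Torus.geometry d) ε a w = z := by
      rw [hw, ← Alexander.regFlow_add hε hε', add_neg_cancel, Alexander.regFlow_zero hε hε']
    rw [hwz] at h
    -- apply `Φ_{-a}` to `Φ_a (w ∘ σ) = z ∘ σ`
    have := congrArg (Alexander.regFlow (Torus.geometry d) ε (-a)) h
    rw [← Alexander.regFlow_add hε hε', neg_add_cancel, Alexander.regFlow_zero hε hε'] at this
    exact this.symm
  rw [hflowδ, htag, htag, hfloww, hWσ]


include hε' in
/-- The genericity set of `event_term_eq_flux` is measurable. [folklore] -/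
theorem measurableSet_gen {k m : ℕ} (I L : Fin (k + m)) (δ : ℝ) :
    MeasurableSet {w : Config (k + m) d (UnitAddTorus d) |
      (w ∘ Fin.castAdd m : Config k d (UnitAddTorus d)) ∈ Alexander.good (Torus.geometry d) ε ∧
      ENNReal.ofReal δ < Alexander.freeExitTime (Torus.geometry d) ε (w ∘ Fin.castAdd m : Config k d (UnitAddTorus d)) ∧
      (collidePair (Torus.geometry d) I L w ∘ Fin.castAdd m : Config k d (UnitAddTorus d)) ∈ Alexander.good (Torus.geometry d) ε ∧
      ENNReal.ofReal δ < Alexander.freeExitTime (Torus.geometry d) ε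
        (flipVel (collidePair (Torus.geometry d) I L w ∘ Fin.castAdd m : Config k d (UnitAddTorus d)))} := by
  have hGm := Torus.isMeasurable_geometry (d := d)
  have hπ : Measurable fun w : Config (k + m) d (UnitAddTorus d) => (w ∘ Fin.castAdd m : Config k d (UnitAddTorus d)) :=
    measurable_pi_lambda _ fun j => measurable_pi_apply _
  have hcPm : Measurable (collidePair (Torus.geometry d) I L) := hGm.measurable_collidePair I L
  have hgoodk : MeasurableSet (Alexander.good (Torus.geometry d) ε : Set (Config k d (UnitAddTorus d))) :=
    Alexander.measurableSet_good (Torus.isHardSphereRegular_geometry hε') hGm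
  have hexitm : Measurable (Alexander.freeExitTime (N := k) (Torus.geometry d) ε) :=
    Alexander.measurable_freeExitTime (Torus.isHardSphereRegular_geometry hε') hGm
  have h1 : MeasurableSet ((fun w : Config (k + m) d (UnitAddTorus d) => (w ∘ Fin.castAdd m : Config k d (UnitAddTorus d))) ⁻¹'
      Alexander.good (Torus.geometry d) ε) := hgoodk.preimage hπ
  have h2 : MeasurableSet ((fun w : Config (k + m) d (UnitAddTorus d) =>
      Alexander.freeExitTime (Torus.geometry d) ε (w ∘ Fin.castAdd m : Config k d (UnitAddTorus d))) ⁻¹' Ioi (ENNReal.ofReal δ)) :=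
    measurableSet_Ioi.preimage (hexitm.comp hπ)
  have h3 : MeasurableSet ((fun w : Config (k + m) d (UnitAddTorus d) =>
      (collidePair (Torus.geometry d) I L w ∘ Fin.castAdd m : Config k d (UnitAddTorus d))) ⁻¹' Alexander.good (Torus.geometry d) ε) :=
    hgoodk.preimage (hπ.comp hcPm)
  have h4 : MeasurableSet ((fun w : Config (k + m) d (UnitAddTorus d) =>
      Alexander.freeExitTime (Torus.geometry d) ε (flipVel (collidePair (Torus.geometry d) I L w ∘ Fin.castAdd m : Config k d (UnitAddTorus d)))) ⁻¹'
        Ioi (ENNReal.ofReal δ)) :=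
    measurableSet_Ioi.preimage (hexitm.comp (measurable_flipVel.comp (hπ.comp hcPm)))
  convert h1.inter (h2.inter (h3.inter h4)) using 1
  ext w
  simp only [Set.mem_setOf_eq, Set.mem_inter_iff, Set.mem_preimage, Set.mem_Ioi]

set_option maxHeartbeats 1000000 in
include hε hε' in
/-- The integrand `H` of `event_term_eq_flux` is jointly measurable. [folklore] -/
theorem measurable_eventIntegrand {k m : ℕ} (I L : Fin (k + m)) (a : ℝ) {B : Set (Config k d (UnitAddTorus d))} (hB : MeasurableSet B)
    {W : Config (k + m) d (UnitAddTorus d) → ℝ} (hW : Measurable W) {Gen : Set (Config (k + m) d (UnitAddTorus d))} (hGen : MeasurableSet Gen) :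
    Measurable fun p : ℝ × Config (k + m) d (UnitAddTorus d) => Gen.indicator (fun w =>
      ((Alexander.regFlow (Torus.geometry d) ε (a + p.1) '' B).indicator (1 : Config k d (UnitAddTorus d) → ℝ) (w ∘ Fin.castAdd m) -
        (Alexander.regFlow (Torus.geometry d) ε (a + p.1) '' B).indicator (1 : Config k d (UnitAddTorus d) → ℝ)
          (collidePair (Torus.geometry d) I L w ∘ Fin.castAdd m)) *
      W (Alexander.regFlow (Torus.geometry d) ε (-(a + p.1)) w)) p.2 := by
  classical
  have hGm := Torus.isMeasurable_geometry (d := d)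
  have hπ : Measurable fun w : Config (k + m) d (UnitAddTorus d) => (w ∘ Fin.castAdd m : Config k d (UnitAddTorus d)) :=
    measurable_pi_lambda _ fun j => measurable_pi_apply _
  have hcPm : Measurable (collidePair (Torus.geometry d) I L) := hGm.measurable_collidePair I L
  have himage : ∀ (τ : ℝ) (y : Config k d (UnitAddTorus d)),
      (Alexander.regFlow (Torus.geometry d) ε (a + τ) '' B).indicator (1 : Config k d (UnitAddTorus d) → ℝ) y =
        B.indicator (1 : Config k d (UnitAddTorus d) → ℝ) (Alexander.regFlow (Torus.geometry d) ε (-(a + τ)) y) := by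
    intro τ y
    by_cases h : y ∈ Alexander.regFlow (Torus.geometry d) ε (a + τ) '' B
    · rw [indicator_of_mem h, indicator_of_mem ((mem_image_regFlow_iff hε hε' _ B y).1 h), Pi.one_apply, Pi.one_apply]
    · rw [indicator_of_notMem h, indicator_of_notMem (fun h' => h ((mem_image_regFlow_iff hε hε' _ B y).2 h'))]
  have hneg : Measurable fun p : ℝ × Config (k + m) d (UnitAddTorus d) => -(a + p.1) := (measurable_fst.const_add a).neg
  have hUk := Alexander.measurable_regFlow_uncurry (d := d) (N := k) hε'
  have hUN := Alexander.measurable_regFlow_uncurry (d := d) (N := k + m) hε'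
  -- (elaborate the compositions without expected type: the direct terms time out)
  have hin1 : Measurable fun p : ℝ × Config (k + m) d (UnitAddTorus d) =>
      ((-(a + p.1), (p.2 ∘ Fin.castAdd m : Config k d (UnitAddTorus d))) : ℝ × Config k d (UnitAddTorus d)) :=
    hneg.prodMk (hπ.comp measurable_snd)
  have hin2 : Measurable fun p : ℝ × Config (k + m) d (UnitAddTorus d) =>
      ((-(a + p.1), (collidePair (Torus.geometry d) I L p.2 ∘ Fin.castAdd m : Config k d (UnitAddTorus d))) : ℝ × Config k d (UnitAddTorus d)) :=
    hneg.prodMk (hπ.comp (hcPm.comp measurable_snd))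
  have hin3 : Measurable fun p : ℝ × Config (k + m) d (UnitAddTorus d) => ((-(a + p.1), p.2) : ℝ × Config (k + m) d (UnitAddTorus d)) :=
    hneg.prodMk measurable_snd
  have hR1 : Measurable fun p : ℝ × Config (k + m) d (UnitAddTorus d) =>
      Alexander.regFlow (Torus.geometry d) ε (-(a + p.1)) (p.2 ∘ Fin.castAdd m : Config k d (UnitAddTorus d)) := by
    have h := hUk.comp hin1
    exact h
  have hR2 : Measurable fun p : ℝ × Config (k + m) d (UnitAddTorus d) =>
      Alexander.regFlow (Torus.geometry d) ε (-(a + p.1)) (collidePair (Torus.geometry d) I L p.2 ∘ Fin.castAdd m : Config k d (UnitAddTorus d)) := by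
    have h := hUk.comp hin2
    exact h
  have hRN : Measurable fun p : ℝ × Config (k + m) d (UnitAddTorus d) => Alexander.regFlow (Torus.geometry d) ε (-(a + p.1)) p.2 := by
    have h := hUN.comp hin3
    exact h
  have hbody : Measurable fun p : ℝ × Config (k + m) d (UnitAddTorus d) =>
      ((Alexander.regFlow (Torus.geometry d) ε (a + p.1) '' B).indicator (1 : Config k d (UnitAddTorus d) → ℝ) (p.2 ∘ Fin.castAdd m) -
        (Alexander.regFlow (Torus.geometry d) ε (a + p.1) '' B).indicator (1 : Config k d (UnitAddTorus d) → ℝ)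
          (collidePair (Torus.geometry d) I L p.2 ∘ Fin.castAdd m)) *
      W (Alexander.regFlow (Torus.geometry d) ε (-(a + p.1)) p.2) := by
    simp_rw [himage]
    exact (((measurable_const.indicator hB).comp hR1).sub ((measurable_const.indicator hB).comp hR2)).mul (hW.comp hRN)
  show Measurable fun p : ℝ × Config (k + m) d (UnitAddTorus d) => if p.2 ∈ Gen then
      ((Alexander.regFlow (Torus.geometry d) ε (a + p.1) '' B).indicator (1 : Config k d (UnitAddTorus d) → ℝ) (p.2 ∘ Fin.castAdd m) -
        (Alexander.regFlow (Torus.geometry d) ε (a + p.1) '' B).indicator (1 : Config k d (UnitAddTorus d) → ℝ)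
          (collidePair (Torus.geometry d) I L p.2 ∘ Fin.castAdd m)) *
      W (Alexander.regFlow (Torus.geometry d) ε (-(a + p.1)) p.2) else 0
  exact Measurable.ite (measurable_snd hGen) hbody measurable_const

set_option maxHeartbeats 1000000 in
include hε hε' in
/-- **The event term of a window in collision coordinates** (CIP 1994 App. 4.B, per window). For
the single-collision event `E` of the window `(0, δ]` for the tagged sphere `I = castAdd i` and the
last (untagged) sphere `L`, a window start `a ≥ 0`, a chart radius `ρ` with `ε + δ V ≤ ρ < 1/2`,
a measurable `B` and an integrable measurable weight `W`: the event term
`∫ 1_E(z) (ψ_{a+δ}(π Φ_δ z) - ψ_a(π z)) W(Φ_{-a} z) dz` equals, up to an error bounded by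
`∫ 1_E (1_{fast} + 2·1_{not generic}) |W ∘ Φ_{-a}|`, the integral over the collision coordinates
`((Z', v), (ν, τ))`, `τ ∈ (0, δ]`, of
`ε^{d-1}(⟪v - v_i, ν⟫)₊ 1_{slow} 1_E(S_{-τ} gainConfig) H(τ, lossConfig Z' i ν v)` with
`H(τ, w) = 1_{Gen}(w) (1_{Φ^k_{a+τ}B}(π w) - 1_{Φ^k_{a+τ}B}(π collidePair I L w)) W(Φ_{-(a+τ)} w)`
(`bracket_of_mem_singleCollisionEvent`, `regFlow_collisionInstant_eq_of_mem`,
`integral_singleCollisionEvent_eq`); here *generic* (`Gen`) means that the tagged blocks of the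
outgoing and of the incoming configuration are good with first exit times (forward, resp.
backward) beyond `δ`, and *slow* that the colliding pair has relative speed `≤ V`.
[cite: CIP1994, App. 4.B] -/
theorem event_term_eq_flux [Nonempty d] {k m' : ℕ} [NeZero k] (i : Fin k) {a δ V ρ : ℝ}
    (hρ : ρ < 1 / 2) (hδV : ε + δ * V ≤ ρ)
    {B : Set (Config k d (UnitAddTorus d))} (hB : MeasurableSet B)
    {W : Config (k + (m' + 1)) d (UnitAddTorus d) → ℝ} (hW : Measurable W) (hWi : Integrable W)
    (Gen : Set (Config (k + (m' + 1)) d (UnitAddTorus d)))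
    (hGen : Gen = {w | (w ∘ Fin.castAdd (m' + 1) : Config k d (UnitAddTorus d)) ∈ Alexander.good (Torus.geometry d) ε ∧
      ENNReal.ofReal δ < Alexander.freeExitTime (Torus.geometry d) ε (w ∘ Fin.castAdd (m' + 1) : Config k d (UnitAddTorus d)) ∧
      (collidePair (Torus.geometry d) (Fin.castAdd (m' + 1) i) (Fin.natAdd k (Fin.last m')) w ∘ Fin.castAdd (m' + 1) :
        Config k d (UnitAddTorus d)) ∈ Alexander.good (Torus.geometry d) ε ∧
      ENNReal.ofReal δ < Alexander.freeExitTime (Torus.geometry d) ε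
        (flipVel (collidePair (Torus.geometry d) (Fin.castAdd (m' + 1) i) (Fin.natAdd k (Fin.last m')) w ∘ Fin.castAdd (m' + 1) :
          Config k d (UnitAddTorus d)))})
    (H : ℝ → Config (k + (m' + 1)) d (UnitAddTorus d) → ℝ)
    (hHdef : H = fun τ w => Gen.indicator (fun w =>
      ((Alexander.regFlow (Torus.geometry d) ε (a + τ) '' B).indicator (1 : Config k d (UnitAddTorus d) → ℝ)
          (w ∘ Fin.castAdd (m' + 1)) -
        (Alexander.regFlow (Torus.geometry d) ε (a + τ) '' B).indicator (1 : Config k d (UnitAddTorus d) → ℝ)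
          (collidePair (Torus.geometry d) (Fin.castAdd (m' + 1) i) (Fin.natAdd k (Fin.last m')) w ∘ Fin.castAdd (m' + 1))) *
      W (Alexander.regFlow (Torus.geometry d) ε (-(a + τ)) w)) w) :
    |(∫ z, (Alexander.singleCollisionEvent (Torus.geometry d) ε (Fin.castAdd (m' + 1) i) (Fin.natAdd k (Fin.last m')) δ).indicator
          (1 : Config (k + (m' + 1)) d (UnitAddTorus d) → ℝ) z *
        (((Alexander.regFlow (Torus.geometry d) ε (a + δ) '' B).indicator (1 : Config k d (UnitAddTorus d) → ℝ)
              (Alexander.regFlow (Torus.geometry d) ε δ z ∘ Fin.castAdd (m' + 1)) -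
            (Alexander.regFlow (Torus.geometry d) ε a '' B).indicator (1 : Config k d (UnitAddTorus d) → ℝ) (z ∘ Fin.castAdd (m' + 1))) *
          W (Alexander.regFlow (Torus.geometry d) ε (-a) z))) -
      ∫ p, ε ^ (Fintype.card d - 1) * max ⟪p.1.2 - (p.1.1 (Fin.castAdd m' i)).2, (p.2.1 : EuclideanSpace ℝ d)⟫_ℝ 0 *
          {v : EuclideanSpace ℝ d | ‖v - (p.1.1 (Fin.castAdd m' i)).2‖ ≤ V}.indicator (1 : EuclideanSpace ℝ d → ℝ) p.1.2 *
          (Alexander.singleCollisionEvent (Torus.geometry d) ε (Fin.castAdd 1 (Fin.castAdd m' i)) (Fin.natAdd (k + m') 0) δ).indicator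
            (1 : Config (k + m' + 1) d (UnitAddTorus d) → ℝ)
            (freeFlight (Torus.geometry d) (-p.2.2) (gainConfig (Torus.geometry d) ε p.1.1 (Fin.castAdd m' i) p.2.1 p.1.2)) *
          H p.2.2 (lossConfig (Torus.geometry d) ε p.1.1 (Fin.castAdd m' i) p.2.1 p.1.2)
        ∂((((volume : Measure (Config (k + m') d (UnitAddTorus d))).prod (volume : Measure (EuclideanSpace ℝ d))).prod
          ((((volume : Measure (EuclideanSpace ℝ d)).toSphere).prod ((volume : Measure ℝ).restrict (Ioc 0 δ))))))| ≤
      ∫ z, (Alexander.singleCollisionEvent (Torus.geometry d) ε (Fin.castAdd (m' + 1) i) (Fin.natAdd k (Fin.last m')) δ).indicator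
          (1 : Config (k + (m' + 1)) d (UnitAddTorus d) → ℝ) z *
        (({z : Config (k + (m' + 1)) d (UnitAddTorus d) |
              V < ‖(z (Fin.natAdd k (Fin.last m'))).2 - (z (Fin.castAdd (m' + 1) i)).2‖}.indicator
              (1 : Config (k + (m' + 1)) d (UnitAddTorus d) → ℝ) z +
            2 * Genᶜ.indicator (1 : Config (k + (m' + 1)) d (UnitAddTorus d) → ℝ)
              (collidePair (Torus.geometry d) (Fin.castAdd (m' + 1) i) (Fin.natAdd k (Fin.last m'))
                (freeFlight (Torus.geometry d) (Alexander.collisionInstant (Torus.geometry d) ε z 1).toReal z))) *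
          |W (Alexander.regFlow (Torus.geometry d) ε (-a) z)|) := by
  classical
  have hG := Torus.isHardSphereRegular_geometry (d := d) hε'
  have hGm := Torus.isMeasurable_geometry (d := d)
  haveI : NeZero (k + m') := ⟨by have := NeZero.ne k; omega⟩
  -- indices and the event in the two index forms
  set I : Fin (k + (m' + 1)) := Fin.castAdd (m' + 1) i with hI
  set L : Fin (k + (m' + 1)) := Fin.natAdd k (Fin.last m') with hL
  set i' : Fin (k + m') := Fin.castAdd m' i with hi'
  have hI' : (Fin.castAdd 1 i' : Fin (k + m' + 1)) = I := Fin.ext rfl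
  have hL' : (Fin.natAdd (k + m') 0 : Fin (k + m' + 1)) = L := Fin.ext (by simp [hL])
  have hIL : I ≠ L := by intro h; have := congrArg Fin.val h; simp [hI, hL] at this; omega
  set E := Alexander.singleCollisionEvent (Torus.geometry d) ε I L δ with hE
  have hE' : Alexander.singleCollisionEvent (Torus.geometry d) ε (Fin.castAdd 1 i') (Fin.natAdd (k + m') 0) δ = E := by
    rw [hI', hL']
  have houtRep : ∀ w : Config (k + (m' + 1)) d (UnitAddTorus d), outRep (Torus.geometry d) (k + m') i' w = collidePair (Torus.geometry d) I L w := by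
    intro w; unfold outRep; rw [hI', hL']
  rw [hE']
  -- abbreviations
  set t₁ : Config (k + (m' + 1)) d (UnitAddTorus d) → ℝ := fun z => (Alexander.collisionInstant (Torus.geometry d) ε z 1).toReal with ht₁
  set cP := collidePair (Torus.geometry d) I L with hcP
  set wout : Config (k + (m' + 1)) d (UnitAddTorus d) → Config (k + (m' + 1)) d (UnitAddTorus d) :=
    fun z => cP (freeFlight (Torus.geometry d) (t₁ z) z) with hwout
  set Δ' : Config (k + (m' + 1)) d (UnitAddTorus d) → ℝ := fun z =>
    (Alexander.regFlow (Torus.geometry d) ε (a + δ) '' B).indicator (1 : Config k d (UnitAddTorus d) → ℝ)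
        (Alexander.regFlow (Torus.geometry d) ε δ z ∘ Fin.castAdd (m' + 1)) -
      (Alexander.regFlow (Torus.geometry d) ε a '' B).indicator (1 : Config k d (UnitAddTorus d) → ℝ) (z ∘ Fin.castAdd (m' + 1)) with hΔ'
  set Wa : Config (k + (m' + 1)) d (UnitAddTorus d) → ℝ := fun z => W (Alexander.regFlow (Torus.geometry d) ε (-a) z) with hWa
  set Sl : Set (Config (k + (m' + 1)) d (UnitAddTorus d)) := {z | ‖(z L).2 - (z I).2‖ ≤ V} with hSl
  set Fa : Set (Config (k + (m' + 1)) d (UnitAddTorus d)) := {z | V < ‖(z L).2 - (z I).2‖} with hFa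
  -- bounds
  have hind1 : ∀ (S : Set (Config k d (UnitAddTorus d))) (y : Config k d (UnitAddTorus d)),
      0 ≤ S.indicator (1 : Config k d (UnitAddTorus d) → ℝ) y ∧ S.indicator (1 : Config k d (UnitAddTorus d) → ℝ) y ≤ 1 := by
    intro S y
    by_cases h : y ∈ S
    · rw [indicator_of_mem h, Pi.one_apply]; exact ⟨zero_le_one, le_rfl⟩
    · rw [indicator_of_notMem h]; exact ⟨le_rfl, zero_le_one⟩
  have hΔle : ∀ z, |Δ' z| ≤ 2 := by
    intro z
    simp only [hΔ']
    have h1 := hind1 (Alexander.regFlow (Torus.geometry d) ε (a + δ) '' B) (Alexander.regFlow (Torus.geometry d) ε δ z ∘ Fin.castAdd (m' + 1))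
    have h2 := hind1 (Alexander.regFlow (Torus.geometry d) ε a '' B) (z ∘ Fin.castAdd (m' + 1))
    rw [abs_le]; constructor <;> linarith [h1.1, h1.2, h2.1, h2.2]
  have hHle : ∀ τ w, |H τ w| ≤ |W (Alexander.regFlow (Torus.geometry d) ε (-(a + τ)) w)| := by
    intro τ w
    rw [hHdef]
    simp only
    by_cases hw : w ∈ Gen
    · rw [indicator_of_mem hw, abs_mul]
      refine mul_le_of_le_one_left (abs_nonneg _) ?_
      have h1 := hind1 (Alexander.regFlow (Torus.geometry d) ε (a + τ) '' B) (w ∘ Fin.castAdd (m' + 1))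
      have h2 := hind1 (Alexander.regFlow (Torus.geometry d) ε (a + τ) '' B)
        (collidePair (Torus.geometry d) (Fin.castAdd (m' + 1) i) (Fin.natAdd k (Fin.last m')) w ∘ Fin.castAdd (m' + 1))
      rw [abs_le]; constructor <;> linarith [h1.1, h1.2, h2.1, h2.2]
    · rw [indicator_of_notMem hw, abs_zero]; exact abs_nonneg _
  -- Step 1: the pointwise identity on the event
  have hpt : ∀ z ∈ E, Δ' z * Wa z =
      Sl.indicator (fun z => H (t₁ z) (wout z)) z + (Fa.indicator (fun z => H (t₁ z) (wout z)) z +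
        Genᶜ.indicator (1 : Config (k + (m' + 1)) d (UnitAddTorus d) → ℝ) (wout z) * (Δ' z * Wa z)) := by
    intro z hz
    obtain ⟨hτpos, hτle, -, -, -⟩ := Alexander.singleCollisionEvent_structure hG hIL hz
    -- the weight at the outgoing configuration
    have hflow : Alexander.regFlow (Torus.geometry d) ε (t₁ z) z = wout z := regFlow_collisionInstant_eq_of_mem hε' hIL hz
    have hWa' : Wa z = W (Alexander.regFlow (Torus.geometry d) ε (-(a + t₁ z)) (wout z)) := by
      simp only [hWa]
      rw [← hflow, ← Alexander.regFlow_add hε hε', show -(a + t₁ z) + t₁ z = -a by ring]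
    -- the incoming configuration from the outgoing one
    have hwin : cP (wout z) = freeFlight (Torus.geometry d) (t₁ z) z := by
      simp only [hwout, hcP]; exact collidePair_collidePair hIL _
    by_cases hgen : wout z ∈ Gen
    · -- generic: the bracket formula
      have hgen' := hgen
      rw [hGen] at hgen'
      obtain ⟨hyo, hexo, hyi, hexi⟩ := hgen'
      rw [hwin] at hyi hexi
      have hG1 : ∀ u ∈ Icc 0 δ, Alexander.regFlow (Torus.geometry d) ε u (wout z ∘ Fin.castAdd (m' + 1) : Config k d (UnitAddTorus d)) =
          freeFlight (Torus.geometry d) u (wout z ∘ Fin.castAdd (m' + 1) : Config k d (UnitAddTorus d)) := fun u hu =>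
        regFlow_eq_freeFlight_of_lt hyo hu.1 (lt_of_le_of_lt (ENNReal.ofReal_le_ofReal hu.2) hexo)
      have hG2 : ∀ u ∈ Icc 0 δ, Alexander.regFlow (Torus.geometry d) ε (-u)
          (freeFlight (Torus.geometry d) (t₁ z) z ∘ Fin.castAdd (m' + 1) : Config k d (UnitAddTorus d)) =
          freeFlight (Torus.geometry d) (-u) (freeFlight (Torus.geometry d) (t₁ z) z ∘ Fin.castAdd (m' + 1) : Config k d (UnitAddTorus d)) :=
        fun u hu => regFlow_neg_eq_freeFlight_of_le hε hε' hyi hu.1 ((ENNReal.ofReal_le_ofReal hu.2).trans hexi.le)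
      have hbr := bracket_of_mem_singleCollisionEvent hε hε' (m := m' + 1) hIL hz hG1 hG2 a B
      have hHval : H (t₁ z) (wout z) = Δ' z * Wa z := by
        rw [hHdef]
        simp only
        rw [indicator_of_mem hgen, hWa', hwin]
        congr 1
        simp only [hΔ']
        exact hbr.symm
      rw [indicator_of_notMem (show wout z ∉ Genᶜ from fun h => h hgen), zero_mul, add_zero]
      by_cases hs : z ∈ Sl
      · have hf : z ∉ Fa := fun h => not_lt.2 (show ‖(z L).2 - (z I).2‖ ≤ V from hs) h
        rw [indicator_of_mem hs, indicator_of_notMem hf, add_zero, hHval]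
      · have hf : z ∈ Fa := by
          show V < ‖(z L).2 - (z I).2‖
          exact not_le.1 hs
        rw [indicator_of_notMem hs, indicator_of_mem hf, zero_add, hHval]
    · -- not generic: the whole term is the error
      have hH0 : H (t₁ z) (wout z) = 0 := by
        rw [hHdef]; simp only; rw [indicator_of_notMem hgen]
      have h1 : Sl.indicator (fun z => H (t₁ z) (wout z)) z = 0 := by
        by_cases hs : z ∈ Sl
        · rw [indicator_of_mem hs]; exact hH0
        · rw [indicator_of_notMem hs]
      have h2 : Fa.indicator (fun z => H (t₁ z) (wout z)) z = 0 := by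
        by_cases hs : z ∈ Fa
        · rw [indicator_of_mem hs]; exact hH0
        · rw [indicator_of_notMem hs]
      rw [h1, h2, indicator_of_mem (show wout z ∈ Genᶜ from hgen), Pi.one_apply, one_mul, zero_add, zero_add]
  -- Step 2: measurability
  have hπ : Measurable fun w : Config (k + (m' + 1)) d (UnitAddTorus d) => (w ∘ Fin.castAdd (m' + 1) : Config k d (UnitAddTorus d)) :=
    measurable_pi_lambda _ fun j => measurable_pi_apply _
  have hcPm : Measurable cP := hGm.measurable_collidePair I L
  have hgoodk : MeasurableSet (Alexander.good (Torus.geometry d) ε : Set (Config k d (UnitAddTorus d))) :=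
    Alexander.measurableSet_good (Torus.isHardSphereRegular_geometry hε') hGm
  have hexitm : Measurable (Alexander.freeExitTime (N := k) (Torus.geometry d) ε) :=
    Alexander.measurable_freeExitTime (Torus.isHardSphereRegular_geometry hε') hGm
  have hGenm : MeasurableSet Gen := by rw [hGen]; exact measurableSet_gen hε' I L δ
  have hHm : Measurable fun p : ℝ × Config (k + (m' + 1)) d (UnitAddTorus d) => H p.1 p.2 := by
    rw [hHdef]; exact measurable_eventIntegrand hε hε' I L a hB hW hGenm
  have ht₁m : Measurable t₁ := (Alexander.measurable_collisionInstant hG hGm 1).ennreal_toReal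
  have hwoutm : Measurable wout := hcPm.comp (hGm.measurable_freeFlight₂.comp (ht₁m.prodMk measurable_id))
  have hHzm : Measurable fun z : Config (k + (m' + 1)) d (UnitAddTorus d) => H (t₁ z) (wout z) := hHm.comp (ht₁m.prodMk hwoutm)
  have hEm : MeasurableSet E := Alexander.measurableSet_singleCollisionEvent hG hGm (Alexander.measurableSet_good hG hGm) _ _ δ
  have hSlm : MeasurableSet Sl :=
    measurableSet_le (((measurable_pi_apply _).snd.sub (measurable_pi_apply _).snd).norm) measurable_const
  have hFam : MeasurableSet Fa :=
    measurableSet_lt measurable_const (((measurable_pi_apply _).snd.sub (measurable_pi_apply _).snd).norm)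
  have himgm : ∀ t : ℝ, MeasurableSet (Alexander.regFlow (Torus.geometry d) ε t '' B) := by
    intro t
    have : Alexander.regFlow (Torus.geometry d) ε t '' B = (Alexander.regFlow (Torus.geometry d) ε (-t)) ⁻¹' B := by
      ext y; rw [Set.mem_preimage]; exact mem_image_regFlow_iff hε hε' t B y
    rw [this]; exact hB.preimage (Alexander.measurable_regFlow hε' _)
  have hΔm : Measurable Δ' :=
    ((measurable_const.indicator (himgm _)).comp (hπ.comp (Alexander.measurable_regFlow hε' _))).sub
      ((measurable_const.indicator (himgm _)).comp hπ)
  have hWam : Measurable Wa := hW.comp (Alexander.measurable_regFlow hε' _)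
  -- integrability of the weight along the flow
  have hWai : Integrable Wa := ((measurePreserving_regFlow_volume hε hε' (-a)).integrable_comp hWi.aestronglyMeasurable).2 hWi
  -- the two pieces
  set f₁ : Config (k + (m' + 1)) d (UnitAddTorus d) → ℝ := fun z => E.indicator (fun z => Sl.indicator (fun z => H (t₁ z) (wout z)) z) z with hf₁
  set f₂ : Config (k + (m' + 1)) d (UnitAddTorus d) → ℝ := fun z => E.indicator (1 : Config (k + (m' + 1)) d (UnitAddTorus d) → ℝ) z *
    (Fa.indicator (fun z => H (t₁ z) (wout z)) z + Genᶜ.indicator (1 : Config (k + (m' + 1)) d (UnitAddTorus d) → ℝ) (wout z) * (Δ' z * Wa z))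
    with hf₂
  have hf₁m : Measurable f₁ := (hHzm.indicator hSlm).indicator hEm
  have hf₂m : Measurable f₂ :=
    (measurable_const.indicator hEm).mul ((hHzm.indicator hFam).add (((measurable_const.indicator hGenm.compl).comp hwoutm).mul (hΔm.mul hWam)))
  -- `|H(t₁ z, w_out z)| ≤ |Wa z|` on the event
  have hHz : ∀ z ∈ E, |H (t₁ z) (wout z)| ≤ |Wa z| := by
    intro z hz
    have hflow : Alexander.regFlow (Torus.geometry d) ε (t₁ z) z = wout z := regFlow_collisionInstant_eq_of_mem hε' hIL hz
    have hWa' : Wa z = W (Alexander.regFlow (Torus.geometry d) ε (-(a + t₁ z)) (wout z)) := by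
      simp only [hWa]
      rw [← hflow, ← Alexander.regFlow_add hε hε', show -(a + t₁ z) + t₁ z = -a by ring]
    rw [hWa']; exact hHle _ _
  have hf₁le : ∀ z, |f₁ z| ≤ |Wa z| := by
    intro z
    simp only [hf₁]
    by_cases hz : z ∈ E
    · rw [indicator_of_mem hz]
      by_cases hs : z ∈ Sl
      · rw [indicator_of_mem hs]; exact hHz z hz
      · rw [indicator_of_notMem hs, abs_zero]; exact abs_nonneg _
    · rw [indicator_of_notMem hz, abs_zero]; exact abs_nonneg _
  have hf₂le : ∀ z, |f₂ z| ≤ E.indicator (1 : Config (k + (m' + 1)) d (UnitAddTorus d) → ℝ) z *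
      ((Fa.indicator (1 : Config (k + (m' + 1)) d (UnitAddTorus d) → ℝ) z +
        2 * Genᶜ.indicator (1 : Config (k + (m' + 1)) d (UnitAddTorus d) → ℝ) (wout z)) * |Wa z|) := by
    intro z
    simp only [hf₂]
    by_cases hz : z ∈ E
    swap
    · rw [indicator_of_notMem hz, zero_mul, zero_mul, abs_zero]
    rw [indicator_of_mem hz, Pi.one_apply, one_mul, one_mul]
    have h1 : |Fa.indicator (fun z => H (t₁ z) (wout z)) z| ≤ Fa.indicator (1 : Config (k + (m' + 1)) d (UnitAddTorus d) → ℝ) z * |Wa z| := by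
      by_cases hs : z ∈ Fa
      · rw [indicator_of_mem hs, indicator_of_mem hs, Pi.one_apply, one_mul]; exact hHz z hz
      · rw [indicator_of_notMem hs, indicator_of_notMem hs, abs_zero, zero_mul]
    have h2 : |Genᶜ.indicator (1 : Config (k + (m' + 1)) d (UnitAddTorus d) → ℝ) (wout z) * (Δ' z * Wa z)| ≤
        2 * Genᶜ.indicator (1 : Config (k + (m' + 1)) d (UnitAddTorus d) → ℝ) (wout z) * |Wa z| := by
      by_cases hg : wout z ∈ Genᶜ
      · rw [indicator_of_mem hg, Pi.one_apply, one_mul, mul_one, abs_mul]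
        exact mul_le_mul_of_nonneg_right (hΔle z) (abs_nonneg _)
      · rw [indicator_of_notMem hg, zero_mul, abs_zero, mul_zero, zero_mul]
    calc |Fa.indicator (fun z => H (t₁ z) (wout z)) z + Genᶜ.indicator (1 : Config (k + (m' + 1)) d (UnitAddTorus d) → ℝ) (wout z) * (Δ' z * Wa z)|
        ≤ |Fa.indicator (fun z => H (t₁ z) (wout z)) z| + |Genᶜ.indicator (1 : Config (k + (m' + 1)) d (UnitAddTorus d) → ℝ) (wout z) * (Δ' z * Wa z)| :=
          abs_add_le _ _
      _ ≤ Fa.indicator (1 : Config (k + (m' + 1)) d (UnitAddTorus d) → ℝ) z * |Wa z| +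
          2 * Genᶜ.indicator (1 : Config (k + (m' + 1)) d (UnitAddTorus d) → ℝ) (wout z) * |Wa z| := add_le_add h1 h2
      _ = (Fa.indicator (1 : Config (k + (m' + 1)) d (UnitAddTorus d) → ℝ) z +
          2 * Genᶜ.indicator (1 : Config (k + (m' + 1)) d (UnitAddTorus d) → ℝ) (wout z)) * |Wa z| := by ring
  have hboundle : ∀ z, E.indicator (1 : Config (k + (m' + 1)) d (UnitAddTorus d) → ℝ) z *
      ((Fa.indicator (1 : Config (k + (m' + 1)) d (UnitAddTorus d) → ℝ) z +
        2 * Genᶜ.indicator (1 : Config (k + (m' + 1)) d (UnitAddTorus d) → ℝ) (wout z)) * |Wa z|) ≤ 3 * |Wa z| := by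
    intro z
    have h1 := hind1 ∅ (z ∘ Fin.castAdd (m' + 1))
    have hE1 : 0 ≤ E.indicator (1 : Config (k + (m' + 1)) d (UnitAddTorus d) → ℝ) z ∧ E.indicator (1 : Config (k + (m' + 1)) d (UnitAddTorus d) → ℝ) z ≤ 1 := by
      by_cases h : z ∈ E
      · rw [indicator_of_mem h, Pi.one_apply]; exact ⟨zero_le_one, le_rfl⟩
      · rw [indicator_of_notMem h]; exact ⟨le_rfl, zero_le_one⟩
    have hF1 : 0 ≤ Fa.indicator (1 : Config (k + (m' + 1)) d (UnitAddTorus d) → ℝ) z ∧ Fa.indicator (1 : Config (k + (m' + 1)) d (UnitAddTorus d) → ℝ) z ≤ 1 := by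
      by_cases h : z ∈ Fa
      · rw [indicator_of_mem h, Pi.one_apply]; exact ⟨zero_le_one, le_rfl⟩
      · rw [indicator_of_notMem h]; exact ⟨le_rfl, zero_le_one⟩
    have hG1 : 0 ≤ Genᶜ.indicator (1 : Config (k + (m' + 1)) d (UnitAddTorus d) → ℝ) (wout z) ∧
        Genᶜ.indicator (1 : Config (k + (m' + 1)) d (UnitAddTorus d) → ℝ) (wout z) ≤ 1 := by
      by_cases h : wout z ∈ Genᶜ
      · rw [indicator_of_mem h, Pi.one_apply]; exact ⟨zero_le_one, le_rfl⟩
      · rw [indicator_of_notMem h]; exact ⟨le_rfl, zero_le_one⟩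
    have hW0 := abs_nonneg (Wa z)
    nlinarith [hE1.1, hE1.2, hF1.1, hF1.2, hG1.1, hG1.2, mul_nonneg hE1.1 hW0, mul_nonneg hF1.1 hW0, mul_nonneg hG1.1 hW0,
      mul_nonneg (mul_nonneg hE1.1 hF1.1) hW0, mul_nonneg (mul_nonneg hE1.1 hG1.1) hW0]
  have hboundm : Measurable fun z => E.indicator (1 : Config (k + (m' + 1)) d (UnitAddTorus d) → ℝ) z *
      ((Fa.indicator (1 : Config (k + (m' + 1)) d (UnitAddTorus d) → ℝ) z +
        2 * Genᶜ.indicator (1 : Config (k + (m' + 1)) d (UnitAddTorus d) → ℝ) (wout z)) * |Wa z|) :=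
    (measurable_const.indicator hEm).mul (((measurable_const.indicator hFam).add
      (measurable_const.mul ((measurable_const.indicator hGenm.compl).comp hwoutm))).mul
        (continuous_abs.measurable.comp hWam))
  have hf₁i : Integrable f₁ :=
    Integrable.mono' hWai.abs hf₁m.aestronglyMeasurable (Filter.Eventually.of_forall fun z => by rw [Real.norm_eq_abs]; exact hf₁le z)
  have hboundi : Integrable fun z => E.indicator (1 : Config (k + (m' + 1)) d (UnitAddTorus d) → ℝ) z *
      ((Fa.indicator (1 : Config (k + (m' + 1)) d (UnitAddTorus d) → ℝ) z +
        2 * Genᶜ.indicator (1 : Config (k + (m' + 1)) d (UnitAddTorus d) → ℝ) (wout z)) * |Wa z|) :=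
    Integrable.mono' (hWai.abs.const_mul 3) hboundm.aestronglyMeasurable (Filter.Eventually.of_forall fun z => by
      rw [Real.norm_eq_abs, abs_of_nonneg]
      · exact hboundle z
      · exact mul_nonneg (Set.indicator_nonneg (fun _ _ => zero_le_one) _) (mul_nonneg (add_nonneg
          (Set.indicator_nonneg (fun _ _ => zero_le_one) _) (mul_nonneg zero_le_two (Set.indicator_nonneg (fun _ _ => zero_le_one) _)))
          (abs_nonneg _)))
  have hf₂i : Integrable f₂ :=
    Integrable.mono' hboundi hf₂m.aestronglyMeasurable (Filter.Eventually.of_forall fun z => by rw [Real.norm_eq_abs]; exact hf₂le z)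
  -- the event term as `∫ f₁ + ∫ f₂`
  have hsplit : ∫ z, E.indicator (1 : Config (k + (m' + 1)) d (UnitAddTorus d) → ℝ) z * (Δ' z * Wa z) = (∫ z, f₁ z) + ∫ z, f₂ z := by
    rw [← integral_add hf₁i hf₂i]
    refine integral_congr_ae (Filter.Eventually.of_forall fun z => ?_)
    simp only [hf₁, hf₂]
    by_cases hz : z ∈ E
    · rw [indicator_of_mem hz, indicator_of_mem hz, Pi.one_apply, one_mul, one_mul]; exact hpt z hz
    · rw [indicator_of_notMem hz, indicator_of_notMem hz, zero_mul, zero_mul, zero_add]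
  -- `∫ f₁` in collision coordinates
  have hfeq : ∀ z : Config (k + m' + 1) d (UnitAddTorus d), f₁ z =
      (Alexander.singleCollisionEvent (Torus.geometry d) ε (Fin.castAdd 1 i') (Fin.natAdd (k + m') 0) δ).indicator
        (fun z => {z : Config (k + m' + 1) d (UnitAddTorus d) | ‖(z (Fin.natAdd (k + m') 0)).2 - (z (Fin.castAdd 1 i')).2‖ ≤ V}.indicator
          (fun z => H (Alexander.collisionInstant (Torus.geometry d) ε z 1).toReal
            (outRep (Torus.geometry d) (k + m') i'
              (freeFlight (Torus.geometry d) (Alexander.collisionInstant (Torus.geometry d) ε z 1).toReal z))) z) z := by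
    intro z; simp only [hf₁, houtRep, hI', hL']; rfl
  have hf₁i' : Integrable fun z : Config (k + m' + 1) d (UnitAddTorus d) =>
      (Alexander.singleCollisionEvent (Torus.geometry d) ε (Fin.castAdd 1 i') (Fin.natAdd (k + m') 0) δ).indicator
        (fun z => {z : Config (k + m' + 1) d (UnitAddTorus d) | ‖(z (Fin.natAdd (k + m') 0)).2 - (z (Fin.castAdd 1 i')).2‖ ≤ V}.indicator
          (fun z => H (Alexander.collisionInstant (Torus.geometry d) ε z 1).toReal
            (outRep (Torus.geometry d) (k + m') i'
              (freeFlight (Torus.geometry d) (Alexander.collisionInstant (Torus.geometry d) ε z 1).toReal z))) z) z := by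
    have : (fun z : Config (k + m' + 1) d (UnitAddTorus d) =>
      (Alexander.singleCollisionEvent (Torus.geometry d) ε (Fin.castAdd 1 i') (Fin.natAdd (k + m') 0) δ).indicator
        (fun z => {z : Config (k + m' + 1) d (UnitAddTorus d) | ‖(z (Fin.natAdd (k + m') 0)).2 - (z (Fin.castAdd 1 i')).2‖ ≤ V}.indicator
          (fun z => H (Alexander.collisionInstant (Torus.geometry d) ε z 1).toReal
            (outRep (Torus.geometry d) (k + m') i'
              (freeFlight (Torus.geometry d) (Alexander.collisionInstant (Torus.geometry d) ε z 1).toReal z))) z) z) = f₁ :=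
      funext fun z => (hfeq z).symm
    rw [this]; exact hf₁i
  have hW3a := (integral_singleCollisionEvent_eq hε hε' i' hρ hδV H hHm hf₁i').2
  rw [hE'] at hW3a
  have hf₁eq : ∫ z, f₁ z = ∫ p, ε ^ (Fintype.card d - 1) * max ⟪p.1.2 - (p.1.1 i').2, (p.2.1 : EuclideanSpace ℝ d)⟫_ℝ 0 *
          {v : EuclideanSpace ℝ d | ‖v - (p.1.1 i').2‖ ≤ V}.indicator (1 : EuclideanSpace ℝ d → ℝ) p.1.2 *
          E.indicator (1 : Config (k + m' + 1) d (UnitAddTorus d) → ℝ)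
            (freeFlight (Torus.geometry d) (-p.2.2) (gainConfig (Torus.geometry d) ε p.1.1 i' p.2.1 p.1.2)) *
          H p.2.2 (lossConfig (Torus.geometry d) ε p.1.1 i' p.2.1 p.1.2)
        ∂((((volume : Measure (Config (k + m') d (UnitAddTorus d))).prod (volume : Measure (EuclideanSpace ℝ d))).prod
          ((((volume : Measure (EuclideanSpace ℝ d)).toSphere).prod ((volume : Measure ℝ).restrict (Ioc 0 δ)))))) :=
    (integral_congr_ae (Filter.Eventually.of_forall hfeq)).trans hW3a
  -- conclusion
  rw [hsplit, hf₁eq, add_sub_cancel_left]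
  refine (abs_integral_le_integral_abs).trans (integral_mono hf₂i.abs hboundi fun z => hf₂le z)


set_option maxHeartbeats 1000000 in
include hε hε' in
/-- **Decomposition of a window increment** (CIP 1994 App. 4.A–4.B, one window). For a window
`[a, a + δ]` (`0 ≤ a`, `0 < δ`, `ε + δ V ≤ ρ < 1/2`), a measurable set `B` of good tagged
configurations and an integrable measurable weight `W` symmetric in the untagged labels, the
increment `∫_{good} (ψ_{a+δ}(π Φ_{a+δ} z₀) - ψ_a(π Φ_a z₀)) W(z₀) dz₀` of the tagged observable
`ψ_t = 1_{Φ^k_t B}` equals `m` times the sum over the tagged labels `i` of the flux integrals of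
`event_term_eq_flux`, up to the dirty windows (`abs_increment_sub_sum_le`, the non-good tagged
blocks being null, `volume_good_inter_tagged_not_good_eq_zero`) and the per-label errors of
`event_term_eq_flux` (`setIntegral_event_increment_eq`, `event_term_relabel`).
[cite: CIP1994, App. 4.B] -/
theorem window_increment_decomposition [Nonempty d] [DecidableEq d] {k m' : ℕ} [NeZero k] {a δ V ρ : ℝ} (ha : 0 ≤ a) (hδ : 0 < δ)
    (hρ : ρ < 1 / 2) (hδV : ε + δ * V ≤ ρ)
    {B : Set (Config k d (UnitAddTorus d))} (hB : MeasurableSet B) (hBg : B ⊆ Alexander.good (Torus.geometry d) ε)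
    {W : Config (k + (m' + 1)) d (UnitAddTorus d) → ℝ} (hW : Measurable W) (hWi : Integrable W)
    (hWσ : ∀ (J : Fin (m' + 1)) (z : Config (k + (m' + 1)) d (UnitAddTorus d)),
      W (z ∘ Equiv.swap (Fin.natAdd k J) (Fin.natAdd k (Fin.last m')) : Config (k + (m' + 1)) d (UnitAddTorus d)) = W z)
    (Gen : Fin k → Set (Config (k + (m' + 1)) d (UnitAddTorus d)))
    (hGen : ∀ i, Gen i = {w | (w ∘ Fin.castAdd (m' + 1) : Config k d (UnitAddTorus d)) ∈ Alexander.good (Torus.geometry d) ε ∧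
      ENNReal.ofReal δ < Alexander.freeExitTime (Torus.geometry d) ε (w ∘ Fin.castAdd (m' + 1) : Config k d (UnitAddTorus d)) ∧
      (collidePair (Torus.geometry d) (Fin.castAdd (m' + 1) i) (Fin.natAdd k (Fin.last m')) w ∘ Fin.castAdd (m' + 1) :
        Config k d (UnitAddTorus d)) ∈ Alexander.good (Torus.geometry d) ε ∧
      ENNReal.ofReal δ < Alexander.freeExitTime (Torus.geometry d) ε
        (flipVel (collidePair (Torus.geometry d) (Fin.castAdd (m' + 1) i) (Fin.natAdd k (Fin.last m')) w ∘ Fin.castAdd (m' + 1) :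
          Config k d (UnitAddTorus d)))})
    (H : Fin k → ℝ → Config (k + (m' + 1)) d (UnitAddTorus d) → ℝ)
    (hHdef : ∀ i, H i = fun τ w => (Gen i).indicator (fun w =>
      ((Alexander.regFlow (Torus.geometry d) ε (a + τ) '' B).indicator (1 : Config k d (UnitAddTorus d) → ℝ)
          (w ∘ Fin.castAdd (m' + 1)) -
        (Alexander.regFlow (Torus.geometry d) ε (a + τ) '' B).indicator (1 : Config k d (UnitAddTorus d) → ℝ)
          (collidePair (Torus.geometry d) (Fin.castAdd (m' + 1) i) (Fin.natAdd k (Fin.last m')) w ∘ Fin.castAdd (m' + 1))) *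
      W (Alexander.regFlow (Torus.geometry d) ε (-(a + τ)) w)) w) :
    |(∫ z₀ in Alexander.good (Torus.geometry d) ε,
        ((Alexander.regFlow (Torus.geometry d) ε (a + δ) '' B).indicator (1 : Config k d (UnitAddTorus d) → ℝ)
            (Alexander.regFlow (Torus.geometry d) ε (a + δ) z₀ ∘ Fin.castAdd (m' + 1)) -
          (Alexander.regFlow (Torus.geometry d) ε a '' B).indicator (1 : Config k d (UnitAddTorus d) → ℝ)
            (Alexander.regFlow (Torus.geometry d) ε a z₀ ∘ Fin.castAdd (m' + 1))) * W z₀) -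
      (m' + 1 : ℝ) * ∑ i : Fin k,
        ∫ p, ε ^ (Fintype.card d - 1) * max ⟪p.1.2 - (p.1.1 (Fin.castAdd m' i)).2, (p.2.1 : EuclideanSpace ℝ d)⟫_ℝ 0 *
          {v : EuclideanSpace ℝ d | ‖v - (p.1.1 (Fin.castAdd m' i)).2‖ ≤ V}.indicator (1 : EuclideanSpace ℝ d → ℝ) p.1.2 *
          (Alexander.singleCollisionEvent (Torus.geometry d) ε (Fin.castAdd 1 (Fin.castAdd m' i)) (Fin.natAdd (k + m') 0) δ).indicator
            (1 : Config (k + m' + 1) d (UnitAddTorus d) → ℝ)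
            (freeFlight (Torus.geometry d) (-p.2.2) (gainConfig (Torus.geometry d) ε p.1.1 (Fin.castAdd m' i) p.2.1 p.1.2)) *
          H i p.2.2 (lossConfig (Torus.geometry d) ε p.1.1 (Fin.castAdd m' i) p.2.1 p.1.2)
        ∂((((volume : Measure (Config (k + m') d (UnitAddTorus d))).prod (volume : Measure (EuclideanSpace ℝ d))).prod
          ((((volume : Measure (EuclideanSpace ℝ d)).toSphere).prod ((volume : Measure ℝ).restrict (Ioc 0 δ))))))| ≤
      2 * (∫ z₀ in Alexander.good (Torus.geometry d) ε,
        {z₀ : Config (k + (m' + 1)) d (UnitAddTorus d) |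
          Alexander.collisionCount (Torus.geometry d) ε z₀ a + 2 ≤ Alexander.collisionCount (Torus.geometry d) ε z₀ (a + δ)}.indicator
            (1 : Config (k + (m' + 1)) d (UnitAddTorus d) → ℝ) z₀ * |W z₀|) +
      (m' + 1 : ℝ) * ∑ i : Fin k,
        ∫ z, (Alexander.singleCollisionEvent (Torus.geometry d) ε (Fin.castAdd (m' + 1) i) (Fin.natAdd k (Fin.last m')) δ).indicator
            (1 : Config (k + (m' + 1)) d (UnitAddTorus d) → ℝ) z *
          (({z : Config (k + (m' + 1)) d (UnitAddTorus d) |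
                V < ‖(z (Fin.natAdd k (Fin.last m'))).2 - (z (Fin.castAdd (m' + 1) i)).2‖}.indicator
                (1 : Config (k + (m' + 1)) d (UnitAddTorus d) → ℝ) z +
              2 * (Gen i)ᶜ.indicator (1 : Config (k + (m' + 1)) d (UnitAddTorus d) → ℝ)
                (collidePair (Torus.geometry d) (Fin.castAdd (m' + 1) i) (Fin.natAdd k (Fin.last m'))
                  (freeFlight (Torus.geometry d) (Alexander.collisionInstant (Torus.geometry d) ε z 1).toReal z))) *
            |W (Alexander.regFlow (Torus.geometry d) ε (-a) z)|) := by
  classical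
  have hG := Torus.isHardSphereRegular_geometry (d := d) hε'
  have hGm := Torus.isMeasurable_geometry (d := d)
  set Φk := Alexander.regHardSphereFlow (d := d) hε hε' k with hΦk
  set ΦN := Alexander.regHardSphereFlow (d := d) hε hε' (k + (m' + 1)) with hΦN
  have hgoodN : MeasurableSet (Alexander.good (Torus.geometry d) ε : Set (Config (k + (m' + 1)) d (UnitAddTorus d))) :=
    Alexander.measurableSet_good hG hGm
  have hgoodk : MeasurableSet (Alexander.good (Torus.geometry d) ε : Set (Config k d (UnitAddTorus d))) :=
    Alexander.measurableSet_good (Torus.isHardSphereRegular_geometry hε') hGm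
  have hπ : Measurable fun w : Config (k + (m' + 1)) d (UnitAddTorus d) => (w ∘ Fin.castAdd (m' + 1) : Config k d (UnitAddTorus d)) :=
    measurable_pi_lambda _ fun j => measurable_pi_apply _
  have himgm : ∀ t : ℝ, MeasurableSet (Alexander.regFlow (Torus.geometry d) ε t '' B) := by
    intro t
    have : Alexander.regFlow (Torus.geometry d) ε t '' B = (Alexander.regFlow (Torus.geometry d) ε (-t)) ⁻¹' B := by
      ext y; rw [Set.mem_preimage]; exact mem_image_regFlow_iff hε hε' t B y
    rw [this]; exact hB.preimage (Alexander.measurable_regFlow hε' _)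
  -- the increment integrand and the classification sets
  set Δ : Config (k + (m' + 1)) d (UnitAddTorus d) → ℝ := fun z₀ =>
    (Alexander.regFlow (Torus.geometry d) ε (a + δ) '' B).indicator (1 : Config k d (UnitAddTorus d) → ℝ)
        (Alexander.regFlow (Torus.geometry d) ε (a + δ) z₀ ∘ Fin.castAdd (m' + 1)) -
      (Alexander.regFlow (Torus.geometry d) ε a '' B).indicator (1 : Config k d (UnitAddTorus d) → ℝ)
        (Alexander.regFlow (Torus.geometry d) ε a z₀ ∘ Fin.castAdd (m' + 1)) with hΔ
  set NG : Set (Config (k + (m' + 1)) d (UnitAddTorus d)) := {z₀ |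
    (Alexander.regFlow (Torus.geometry d) ε a z₀ ∘ Fin.castAdd (m' + 1) : Config k d (UnitAddTorus d)) ∉ Alexander.good (Torus.geometry d) ε} with hNG
  set Dirty : Set (Config (k + (m' + 1)) d (UnitAddTorus d)) := {z₀ |
    Alexander.collisionCount (Torus.geometry d) ε z₀ a + 2 ≤ Alexander.collisionCount (Torus.geometry d) ε z₀ (a + δ)} with hDirty
  set Ev : Fin k × Fin (m' + 1) → Set (Config (k + (m' + 1)) d (UnitAddTorus d)) := fun p =>
    Alexander.singleCollisionEvent (Torus.geometry d) ε (Fin.castAdd (m' + 1) p.1) (Fin.natAdd k p.2) δ with hEv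
  set Sg : Config (k + (m' + 1)) d (UnitAddTorus d) → ℝ := fun z₀ => ∑ p : Fin k × Fin (m' + 1),
    (Ev p).indicator (1 : Config (k + (m' + 1)) d (UnitAddTorus d) → ℝ) (Alexander.regFlow (Torus.geometry d) ε a z₀) with hSg
  -- measurability
  have hΔm : Measurable Δ :=
    ((measurable_const.indicator (himgm _)).comp (hπ.comp (Alexander.measurable_regFlow hε' _))).sub
      ((measurable_const.indicator (himgm _)).comp (hπ.comp (Alexander.measurable_regFlow hε' _)))
  have hNGm : MeasurableSet NG := (hgoodk.compl.preimage (hπ.comp (Alexander.measurable_regFlow hε' a)))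
  have hDirtym : MeasurableSet Dirty := by
    have h1 := Alexander.measurable_collisionCount (N := k + (m' + 1)) hG hGm a
    have h2 := Alexander.measurable_collisionCount (N := k + (m' + 1)) hG hGm (a + δ)
    have : Dirty = (fun z₀ : Config (k + (m' + 1)) d (UnitAddTorus d) =>
        (Alexander.collisionCount (Torus.geometry d) ε z₀ a, Alexander.collisionCount (Torus.geometry d) ε z₀ (a + δ))) ⁻¹'
          {q : ℕ × ℕ | q.1 + 2 ≤ q.2} := rfl
    rw [this]
    exact (Set.to_countable _).measurableSet.preimage (h1.prodMk h2)
  have hEvm : ∀ p, MeasurableSet (Ev p) := fun p =>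
    Alexander.measurableSet_singleCollisionEvent hG hGm (Alexander.measurableSet_good hG hGm) _ _ δ
  have hSgm : Measurable Sg := by
    refine Finset.measurable_sum _ fun p _ => ?_
    exact (measurable_const.indicator (hEvm p)).comp (Alexander.measurable_regFlow hε' a)
  -- bounds
  have hind1 : ∀ (S : Set (Config k d (UnitAddTorus d))) (y : Config k d (UnitAddTorus d)),
      0 ≤ S.indicator (1 : Config k d (UnitAddTorus d) → ℝ) y ∧ S.indicator (1 : Config k d (UnitAddTorus d) → ℝ) y ≤ 1 := by
    intro S y
    by_cases h : y ∈ S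
    · rw [indicator_of_mem h, Pi.one_apply]; exact ⟨zero_le_one, le_rfl⟩
    · rw [indicator_of_notMem h]; exact ⟨le_rfl, zero_le_one⟩
  have hind2 : ∀ (S : Set (Config (k + (m' + 1)) d (UnitAddTorus d))) (y : Config (k + (m' + 1)) d (UnitAddTorus d)),
      0 ≤ S.indicator (1 : Config (k + (m' + 1)) d (UnitAddTorus d) → ℝ) y ∧ S.indicator (1 : Config (k + (m' + 1)) d (UnitAddTorus d) → ℝ) y ≤ 1 := by
    intro S y
    by_cases h : y ∈ S
    · rw [indicator_of_mem h, Pi.one_apply]; exact ⟨zero_le_one, le_rfl⟩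
    · rw [indicator_of_notMem h]; exact ⟨le_rfl, zero_le_one⟩
  have hΔle : ∀ z₀, |Δ z₀| ≤ 2 := by
    intro z₀
    simp only [hΔ]
    have h1 := hind1 (Alexander.regFlow (Torus.geometry d) ε (a + δ) '' B) (Alexander.regFlow (Torus.geometry d) ε (a + δ) z₀ ∘ Fin.castAdd (m' + 1))
    have h2 := hind1 (Alexander.regFlow (Torus.geometry d) ε a '' B) (Alexander.regFlow (Torus.geometry d) ε a z₀ ∘ Fin.castAdd (m' + 1))
    rw [abs_le]; constructor <;> linarith [h1.1, h1.2, h2.1, h2.2]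
  -- the sum of the event indicators is `0` or `1` (the events are disjoint)
  have hSg01 : ∀ z₀, Sg z₀ = 0 ∨ Sg z₀ = 1 := by
    intro z₀
    simp only [hSg]
    by_cases hev : ∃ p : Fin k × Fin (m' + 1), Alexander.regFlow (Torus.geometry d) ε a z₀ ∈ Ev p
    · obtain ⟨p₀, hp₀⟩ := hev
      right
      rw [Finset.sum_eq_single p₀]
      · rw [indicator_of_mem hp₀, Pi.one_apply]
      · intro p _ hp
        rw [indicator_of_notMem]
        intro hpz
        obtain ⟨h1, h2⟩ := eq_of_mem_singleCollisionEvent hε' hpz hp₀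
        exact hp (Prod.ext h1 h2)
      · intro h; exact absurd (Finset.mem_univ p₀) h
    · left
      push Not at hev
      exact Finset.sum_eq_zero fun p _ => indicator_of_notMem (hev p) _
  have hSgle : ∀ z₀, |Sg z₀| ≤ 1 := by
    intro z₀; rcases hSg01 z₀ with h | h <;> rw [h] <;> norm_num
  -- integrability on the good set
  have hWg : IntegrableOn W (Alexander.good (Torus.geometry d) ε) := hWi.integrableOn
  have hΔWi : IntegrableOn (fun z₀ => Δ z₀ * W z₀) (Alexander.good (Torus.geometry d) ε) :=
    Integrable.mono' (hWg.abs.const_mul 2) (hΔm.mul hW).aestronglyMeasurable (Filter.Eventually.of_forall fun z₀ => by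
      rw [Real.norm_eq_abs, abs_mul]; exact mul_le_mul_of_nonneg_right (hΔle z₀) (abs_nonneg _))
  have hSΔWi : IntegrableOn (fun z₀ => Sg z₀ * Δ z₀ * W z₀) (Alexander.good (Torus.geometry d) ε) :=
    Integrable.mono' (hWg.abs.const_mul 2) ((hSgm.mul hΔm).mul hW).aestronglyMeasurable (Filter.Eventually.of_forall fun z₀ => by
      rw [Real.norm_eq_abs, abs_mul, abs_mul]
      have := mul_le_mul (hSgle z₀) (hΔle z₀) (abs_nonneg _) zero_le_one
      nlinarith [abs_nonneg (W z₀), abs_nonneg (Sg z₀), abs_nonneg (Δ z₀)])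
  -- Step A: classification, integrated
  have hA : |(∫ z₀ in Alexander.good (Torus.geometry d) ε, Δ z₀ * W z₀) -
      ∫ z₀ in Alexander.good (Torus.geometry d) ε, Sg z₀ * Δ z₀ * W z₀| ≤
      2 * ∫ z₀ in Alexander.good (Torus.geometry d) ε, Dirty.indicator (1 : Config (k + (m' + 1)) d (UnitAddTorus d) → ℝ) z₀ * |W z₀| := by
    rw [← integral_sub hΔWi hSΔWi]
    have hbound : ∀ z₀ ∈ Alexander.good (Torus.geometry d) ε, |Δ z₀ * W z₀ - Sg z₀ * Δ z₀ * W z₀| ≤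
        2 * (NG.indicator (1 : Config (k + (m' + 1)) d (UnitAddTorus d) → ℝ) z₀ + Dirty.indicator (1 : Config (k + (m' + 1)) d (UnitAddTorus d) → ℝ) z₀) * |W z₀| := by
      intro z₀ hz₀
      have hcls := abs_increment_sub_sum_le hε hε' (m := m' + 1) hBg hz₀ ha hδ (B := B)
      have heq : Δ z₀ * W z₀ - Sg z₀ * Δ z₀ * W z₀ = (Δ z₀ - Sg z₀ * Δ z₀) * W z₀ := by ring
      rw [heq, abs_mul]
      refine mul_le_mul_of_nonneg_right ?_ (abs_nonneg _)
      have hSgΔ : Sg z₀ * Δ z₀ = ∑ p : Fin k × Fin (m' + 1),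
          (Ev p).indicator (1 : Config (k + (m' + 1)) d (UnitAddTorus d) → ℝ) (Alexander.regFlow (Torus.geometry d) ε a z₀) * Δ z₀ := by
        simp only [hSg]; rw [Finset.sum_mul]
      rw [hSgΔ]
      exact hcls
    have hbi : IntegrableOn (fun z₀ => 2 * (NG.indicator (1 : Config (k + (m' + 1)) d (UnitAddTorus d) → ℝ) z₀ +
        Dirty.indicator (1 : Config (k + (m' + 1)) d (UnitAddTorus d) → ℝ) z₀) * |W z₀|) (Alexander.good (Torus.geometry d) ε) := by
      refine Integrable.mono' (hWg.abs.const_mul 4) ?_ (Filter.Eventually.of_forall fun z₀ => ?_)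
      · exact ((measurable_const.mul ((measurable_const.indicator hNGm).add (measurable_const.indicator hDirtym))).mul
          (continuous_abs.measurable.comp hW)).aestronglyMeasurable
      · have h1 := hind2 NG z₀; have h2 := hind2 Dirty z₀
        rw [Real.norm_eq_abs, abs_of_nonneg (by nlinarith [abs_nonneg (W z₀), h1.1, h2.1])]
        nlinarith [abs_nonneg (W z₀), h1.1, h2.1, h1.2, h2.2]
    refine (abs_integral_le_integral_abs).trans ((setIntegral_mono_on (hΔWi.sub hSΔWi).abs hbi hgoodN hbound).trans (le_of_eq ?_))
    -- the non-good tagged blocks are null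
    have hNG0 : ∫ z₀ in Alexander.good (Torus.geometry d) ε, NG.indicator (1 : Config (k + (m' + 1)) d (UnitAddTorus d) → ℝ) z₀ * |W z₀| = 0 := by
      have hnull : volume (Alexander.good (Torus.geometry d) ε ∩ NG) = 0 := by
        have := volume_good_inter_tagged_not_good_eq_zero Φk ΦN a
        simpa [hΦk, hΦN] using this
      refine setIntegral_eq_zero_of_ae_eq_zero ?_
      have hae : ∀ᵐ z₀ : Config (k + (m' + 1)) d (UnitAddTorus d), z₀ ∉ Alexander.good (Torus.geometry d) ε ∩ NG :=
        measure_eq_zero_iff_ae_notMem.1 hnull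
      filter_upwards [hae] with z₀ hz₀ hz₀g
      rw [indicator_of_notMem (fun h => hz₀ ⟨hz₀g, h⟩), zero_mul]
    have hDi : IntegrableOn (fun z₀ => Dirty.indicator (1 : Config (k + (m' + 1)) d (UnitAddTorus d) → ℝ) z₀ * |W z₀|)
        (Alexander.good (Torus.geometry d) ε) :=
      Integrable.mono' hWg.abs ((measurable_const.indicator hDirtym).mul (continuous_abs.measurable.comp hW)).aestronglyMeasurable
        (Filter.Eventually.of_forall fun z₀ => by
          have h2 := hind2 Dirty z₀
          rw [Real.norm_eq_abs, abs_of_nonneg (mul_nonneg h2.1 (abs_nonneg _))]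
          exact mul_le_of_le_one_left (abs_nonneg _) h2.2)
    have hNi : IntegrableOn (fun z₀ => NG.indicator (1 : Config (k + (m' + 1)) d (UnitAddTorus d) → ℝ) z₀ * |W z₀|)
        (Alexander.good (Torus.geometry d) ε) :=
      Integrable.mono' hWg.abs ((measurable_const.indicator hNGm).mul (continuous_abs.measurable.comp hW)).aestronglyMeasurable
        (Filter.Eventually.of_forall fun z₀ => by
          have h2 := hind2 NG z₀
          rw [Real.norm_eq_abs, abs_of_nonneg (mul_nonneg h2.1 (abs_nonneg _))]
          exact mul_le_of_le_one_left (abs_nonneg _) h2.2)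
    have hsplit : (fun z₀ => 2 * (NG.indicator (1 : Config (k + (m' + 1)) d (UnitAddTorus d) → ℝ) z₀ +
        Dirty.indicator (1 : Config (k + (m' + 1)) d (UnitAddTorus d) → ℝ) z₀) * |W z₀|) = fun z₀ =>
        2 * (NG.indicator (1 : Config (k + (m' + 1)) d (UnitAddTorus d) → ℝ) z₀ * |W z₀|) +
          2 * (Dirty.indicator (1 : Config (k + (m' + 1)) d (UnitAddTorus d) → ℝ) z₀ * |W z₀|) := by
      funext z₀; ring
    rw [hsplit, integral_add (hNi.const_mul 2) (hDi.const_mul 2), integral_const_mul, integral_const_mul, hNG0, mul_zero, zero_add]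
  -- Step B: the sum of the event terms
  set T : Fin k → ℝ := fun i => ∫ z,
      (Alexander.singleCollisionEvent (Torus.geometry d) ε (Fin.castAdd (m' + 1) i) (Fin.natAdd k (Fin.last m')) δ).indicator
          (1 : Config (k + (m' + 1)) d (UnitAddTorus d) → ℝ) z *
        (((Alexander.regFlow (Torus.geometry d) ε (a + δ) '' B).indicator (1 : Config k d (UnitAddTorus d) → ℝ)
              (Alexander.regFlow (Torus.geometry d) ε δ z ∘ Fin.castAdd (m' + 1)) -
            (Alexander.regFlow (Torus.geometry d) ε a '' B).indicator (1 : Config k d (UnitAddTorus d) → ℝ) (z ∘ Fin.castAdd (m' + 1))) *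
          W (Alexander.regFlow (Torus.geometry d) ε (-a) z)) with hT
  have hterm : ∀ p : Fin k × Fin (m' + 1),
      ∫ z₀ in Alexander.good (Torus.geometry d) ε, (Ev p).indicator (1 : Config (k + (m' + 1)) d (UnitAddTorus d) → ℝ)
        (Alexander.regFlow (Torus.geometry d) ε a z₀) * (Δ z₀ * W z₀) = T p.1 := by
      intro p
      simp only [hEv, hΔ, hT]
      rw [setIntegral_event_increment_eq hε hε' _ (hEvm p) hB hBg hW a δ]
      rw [setIntegral_eq_integral_of_forall_compl_eq_zero (fun z hz => by
        rw [indicator_of_notMem (fun h => hz h.1), zero_mul])]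
      exact event_term_relabel hε hε' p.1 p.2 ha hδ B (hWσ p.2)
  have htermi : ∀ p : Fin k × Fin (m' + 1), IntegrableOn (fun z₀ => (Ev p).indicator (1 : Config (k + (m' + 1)) d (UnitAddTorus d) → ℝ)
      (Alexander.regFlow (Torus.geometry d) ε a z₀) * (Δ z₀ * W z₀)) (Alexander.good (Torus.geometry d) ε) := by
    intro p
    refine Integrable.mono' hΔWi.abs ?_ (Filter.Eventually.of_forall fun z₀ => ?_)
    · exact (((measurable_const.indicator (hEvm p)).comp (Alexander.measurable_regFlow hε' a)).mul (hΔm.mul hW)).aestronglyMeasurable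
    · have h2 := hind2 (Ev p) (Alexander.regFlow (Torus.geometry d) ε a z₀)
      rw [Real.norm_eq_abs, abs_mul, abs_of_nonneg h2.1]
      exact mul_le_of_le_one_left (abs_nonneg _) h2.2
  have hB' : ∫ z₀ in Alexander.good (Torus.geometry d) ε, Sg z₀ * Δ z₀ * W z₀ = (m' + 1 : ℝ) * ∑ i : Fin k, T i := by
    have hfun : (fun z₀ => Sg z₀ * Δ z₀ * W z₀) = fun z₀ => ∑ p : Fin k × Fin (m' + 1),
        (Ev p).indicator (1 : Config (k + (m' + 1)) d (UnitAddTorus d) → ℝ) (Alexander.regFlow (Torus.geometry d) ε a z₀) * (Δ z₀ * W z₀) := by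
      funext z₀; simp only [hSg]; rw [Finset.sum_mul, Finset.sum_mul]; simp only [mul_assoc]
    rw [hfun, integral_finsetSum _ (fun p _ => htermi p)]
    simp_rw [hterm]
    rw [Fintype.sum_prod_type]
    simp only [Finset.sum_const, Finset.card_univ, Fintype.card_fin, nsmul_eq_mul, Nat.cast_add, Nat.cast_one]
    rw [Finset.mul_sum]
  -- Step D: each label in collision coordinates
  have hD : ∀ i : Fin k, |T i -
      ∫ p, ε ^ (Fintype.card d - 1) * max ⟪p.1.2 - (p.1.1 (Fin.castAdd m' i)).2, (p.2.1 : EuclideanSpace ℝ d)⟫_ℝ 0 *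
          {v : EuclideanSpace ℝ d | ‖v - (p.1.1 (Fin.castAdd m' i)).2‖ ≤ V}.indicator (1 : EuclideanSpace ℝ d → ℝ) p.1.2 *
          (Alexander.singleCollisionEvent (Torus.geometry d) ε (Fin.castAdd 1 (Fin.castAdd m' i)) (Fin.natAdd (k + m') 0) δ).indicator
            (1 : Config (k + m' + 1) d (UnitAddTorus d) → ℝ)
            (freeFlight (Torus.geometry d) (-p.2.2) (gainConfig (Torus.geometry d) ε p.1.1 (Fin.castAdd m' i) p.2.1 p.1.2)) *
          H i p.2.2 (lossConfig (Torus.geometry d) ε p.1.1 (Fin.castAdd m' i) p.2.1 p.1.2)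
        ∂((((volume : Measure (Config (k + m') d (UnitAddTorus d))).prod (volume : Measure (EuclideanSpace ℝ d))).prod
          ((((volume : Measure (EuclideanSpace ℝ d)).toSphere).prod ((volume : Measure ℝ).restrict (Ioc 0 δ))))))| ≤
      ∫ z, (Alexander.singleCollisionEvent (Torus.geometry d) ε (Fin.castAdd (m' + 1) i) (Fin.natAdd k (Fin.last m')) δ).indicator
            (1 : Config (k + (m' + 1)) d (UnitAddTorus d) → ℝ) z *
          (({z : Config (k + (m' + 1)) d (UnitAddTorus d) |
                V < ‖(z (Fin.natAdd k (Fin.last m'))).2 - (z (Fin.castAdd (m' + 1) i)).2‖}.indicator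
                (1 : Config (k + (m' + 1)) d (UnitAddTorus d) → ℝ) z +
              2 * (Gen i)ᶜ.indicator (1 : Config (k + (m' + 1)) d (UnitAddTorus d) → ℝ)
                (collidePair (Torus.geometry d) (Fin.castAdd (m' + 1) i) (Fin.natAdd k (Fin.last m'))
                  (freeFlight (Torus.geometry d) (Alexander.collisionInstant (Torus.geometry d) ε z 1).toReal z))) *
            |W (Alexander.regFlow (Torus.geometry d) ε (-a) z)|) := fun i =>
    event_term_eq_flux hε hε' i hρ hδV hB hW hWi (Gen i) (hGen i) (H i) (hHdef i)
  -- conclusion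
  have hI : (∫ z₀ in Alexander.good (Torus.geometry d) ε,
        ((Alexander.regFlow (Torus.geometry d) ε (a + δ) '' B).indicator (1 : Config k d (UnitAddTorus d) → ℝ)
            (Alexander.regFlow (Torus.geometry d) ε (a + δ) z₀ ∘ Fin.castAdd (m' + 1)) -
          (Alexander.regFlow (Torus.geometry d) ε a '' B).indicator (1 : Config k d (UnitAddTorus d) → ℝ)
            (Alexander.regFlow (Torus.geometry d) ε a z₀ ∘ Fin.castAdd (m' + 1))) * W z₀) =
      ∫ z₀ in Alexander.good (Torus.geometry d) ε, Δ z₀ * W z₀ := by simp only [hΔ]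
  rw [hI]
  calc |(∫ z₀ in Alexander.good (Torus.geometry d) ε, Δ z₀ * W z₀) - (m' + 1 : ℝ) * ∑ i : Fin k, _|
      ≤ |(∫ z₀ in Alexander.good (Torus.geometry d) ε, Δ z₀ * W z₀) - ∫ z₀ in Alexander.good (Torus.geometry d) ε, Sg z₀ * Δ z₀ * W z₀| +
        |(∫ z₀ in Alexander.good (Torus.geometry d) ε, Sg z₀ * Δ z₀ * W z₀) - (m' + 1 : ℝ) * ∑ i : Fin k, _| := abs_sub_le _ _ _
    _ ≤ 2 * (∫ z₀ in Alexander.good (Torus.geometry d) ε, Dirty.indicator (1 : Config (k + (m' + 1)) d (UnitAddTorus d) → ℝ) z₀ * |W z₀|) +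
        (m' + 1 : ℝ) * ∑ i : Fin k, _ := add_le_add hA ?_
  rw [hB', ← mul_sub, abs_mul, abs_of_nonneg (by positivity : (0 : ℝ) ≤ m' + 1), ← Finset.sum_sub_distrib]
  refine mul_le_mul_of_nonneg_left ((Finset.abs_sum_le_sum_abs _ _).trans (Finset.sum_le_sum fun i _ => hD i)) (by positivity)

end Window





end Kinetic

end

end Literature.MathematicalPhysics.KineticTheory
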